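import Mathlib
import Literature.Analysis.FluidPDE.Wei2016HardyCutoff
import Literature.Analysis.FluidPDE.SteadyNSLiouvilleLpDirichlet
import Literature.Analysis.FluidPDE.PlanarCircleWirtinger
import Literature.Analysis.FluidPDE.CylindricalCutoff
import Literature.Analysis.FluidPDE.HomogeneousEulerProofs
import Literature.Analysis.FluidPDE.SteadyNSLocalEnergy
import Literature.Analysis.FluidPDE.SteadyHelicalLiouville
import Literature.Analysis.FluidPDE.KNSSLineInvariantLiouville
import Literature.Analysis.FluidPDE.GigaMiura2011ScaledAlignmentBlowupLimitHolds
import Literature.Analysis.FluidPDE.SteadyNSBoundedAnalytic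
import Literature.Analysis.FluidPDE.SteadyPeriodicSlabLiouvilleSymmetricCases
import Literature.Analysis.FluidPDE.PeriodicSlabSteadyLiouville
import HarnessLib

/-!
# Steady Navier–Stokes Liouville theorems in the periodic slab, file 4 of 4: the stream-function corrector and the radial-decay case (Thm 1.4 (c)) — `BangGuiWangXie2025_periodicSlab_liouville` HOLDS (re-homed proofs)

**Two Liouville theorems for bounded smooth steady Navier–Stokes flows on `ℝ³` that are periodic in the axial variable.**
(1) Q. Han, Y. Wang, C. Xie, *Liouville-type theorems for steady Navier–Stokes system under helical symmetry or Navier boundary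
conditions*, arXiv:2312.10382 = Sci. China Math. (2025), Theorem 1.1 [HanWangXie2023]: for every viscosity `ν > 0` and pitch
`κ ≠ 0`, a bounded smooth helically symmetric steady solution on `ℝ³` is an axial constant `C e₃` — the named fact
`Literature.Analysis.FluidPDE.HanWangXie2023_helical_liouville` (`SteadyHelicalLiouville.lean`).  (2) J. Bang, C. Gui, Y. Wang,
C. Xie, *Liouville-type theorems for steady solutions to the Navier–Stokes system in a slab*, arXiv:2205.13259 = J. Fluid Mech.
1005 (2025) A6, Theorem 1.4 [BangGuiWangXie2025]: a bounded smooth steady solution on `ℝ³`, `L`-periodic in `x₃`, is an axial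
constant as soon as (a) its swirl velocity is axisymmetric, or (b) its radial velocity is axisymmetric, or (c) `r u^r → 0`
uniformly as `r → ∞`; and (d) it is constant when `sup ‖U‖ < 2πν/L` — the named fact
`Literature.Analysis.FluidPDE.BangGuiWangXie2025_periodicSlab_liouville` (`PeriodicSlabSteadyLiouville.lean`).  Both facts are
PROVED in the tree by the Navier–Stokes blow-up-scenario census cell (`pub/ns-census`, rows S6/S7: periodic pressure, the
Poincaré–Wirtinger inequality on vertical periods, the helical / axisymmetric zero-flux of the radial velocity, foot-point
splitting of the pressure, a stream-function corrector in case (c), weighted dyadic energy (Saint-Venant) estimates) — until now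
Summits-side only (`Summits/NavierStokesRegularity/NavierStokesRegularity/Theorems/ScenarioCensusSteadyS6.lean`, `…S7.lean`).
RE-HOMED into `Literature/` by the Hodge foundations lane (`lit-hodgefound`, prover p20, generation 39) as FOUR files: verbatim
DECLARATION-LEVEL ports (the 135 declarations the two discharges need, in dependency order; each Part header lists the
declarations of its source module that are NOT carried) of 29 Summits modules
`Summits/NavierStokesRegularity/NavierStokesRegularity/Theorems/ScenarioCensus{PeriodicSlab,HelicalSlab}*.lean`, namespaces
`Summit.NavierStokesRegularity.NavierStokesRegularity.Theorems.ScenarioCensus{,.PeriodicSlab,.HelicalSlab}` re-rooted to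
`Literature.Analysis.SteadySlabLiouville{,.PeriodicSlab,.HelicalSlab}` (a root outside `Literature.Analysis.FluidPDE` on purpose:
namespace-prefix resolution would otherwise shadow the cone's lemmas by same-named `FluidPDE` lemmas); imports from `Literature/`
and Mathlib only; no `sorry`, no new axiom, NO named fact (D-0026); the census-row aliases `Row_S6`, `Row_S7`, `Row_S7c` and
`row_S*_excluded` of `ScenarioCensusSteady{,S6,S7}.lean` are Summits bookkeeping and are not carried.  PROVENANCE CONVENTION:
docstrings are carried byte-for-byte; declarations the cell cites keep their cites; `[folklore]`-tagged and untagged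
declarations (the cell's own lemmas) carry the Part's tag `[cite: <Key>, <loc> (source of the ARGUMENT this module implements;
this declaration is the cell's own lemma or plumbing, NOT a printed statement)]`, because the gate does not admit a public
Literature theorem without a cite tag.

THIS FILE (4 of 4) ports: ScenarioCensusPeriodicSlabCorrector, ScenarioCensusPeriodicSlabDecayMean, ScenarioCensusPeriodicSlabDecayTerms, ScenarioCensusPeriodicSlabDecayLiouville.
-/

noncomputable section

/-!
## Part 1 — port of `Summits/NavierStokesRegularity/NavierStokesRegularity/Theorems/ScenarioCensusPeriodicSlabCorrector.lean` (5 declarations kept)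

# Census row S7 (c): the stream-function corrector `Ψ = Φ̃ J∇φ` and the corrector identity
# `∫_S P div Ψ = Σᵢ ∫_S ⟪∂ᵢU, ∂ᵢΨ⟫ + ∫_S ⟪(U·∇)U, Ψ⟫`

Support file for the scenario census of `NavierStokesRegularity` (cell `pub/ns-census`, block S,
row S7 = Bang–Gui–Wang–Xie, J. Fluid Mech. 1005 (2025) A6 = arXiv:2205.13259, Thm 1.4 (c)). The
printed proof of case (c) (§5 Step 3) writes the cut-off pressure term as
`∫ P · r u^r = ∫ P div Ψ_R = −∫ ∇P · Ψ_R` for a Bogovskiĭ corrector `Ψ_R ∈ H¹₀` of the annular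
period cell and then uses the momentum equation `∇P = Δu − (u·∇)u`. Here:

* `corrector_identity` — for a `C¹` axially periodic test field `Ψ` vanishing with its derivative
  off a cylinder and a smooth steady Navier–Stokes flow `(U, P)` at unit viscosity with `U`, `P`
  axially `L`-periodic: `∫_S P div Ψ = Σᵢ ∫_S ⟪∂ᵢU, ∂ᵢΨ⟫ + ∫_S ⟪(U·∇)U, Ψ⟫` on one period
  `S = zSlab L 0` (whole-space identities of `WholeSpaceIBP` against `ω_L(x₂)² Ψ`, the window
  derivative terms vanish by `window_bookkeeping`);
* `streamCorrectorField` — the tree's corrector `Ψ(x) = Φ̃(x) W(x)`, `W = corrField r = J∇φ`,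
  `Φ̃ = streamCorrector g`: `C¹`, `z`-invariant, `div Ψ = a ⟪x_h, g(x_h)⟫`
  (`divergence_streamCorrectorField`), and the pointwise bounds
  `‖Ψ‖ ≤ |Φ̃| (C/r) χ`, `‖DΨ‖ ≤ (‖DΦ̃‖ C/r + |Φ̃| C/r²) χ` (`streamCorrectorField_bounds`).

No summit statement and no census row is proved in this file.

## References

* J. Bang, C. Gui, Y. Wang, C. Xie, arXiv:2205.13259, §5 Step 3, (4-19)–(4-20).
  [BangGuiWangXie2025]

Not carried from this source module (not needed by the declarations re-homed here; their consumers are Summits-side): `contDiff_streamCorrector`.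
-/

section Part1

open _root_.MeasureTheory _root_.Set _root_.Function _root_.Filter _root_.InnerProductSpace
open scoped _root_.Topology RealInnerProductSpace Laplacian

namespace Literature.Analysis.SteadySlabLiouville.PeriodicSlab

open Literature.Analysis Literature.Analysis.FluidPDE

/-! ### The corrector identity on one period -/

/-- **The corrector identity.** Let `U ∈ C²`, `P ∈ C¹` satisfy the steady Navier–Stokes momentum
equation at unit viscosity, `(U·∇)U = ΔU − ∇P`, with `U`, `P` axially `L`-periodic (`L > 0`), and
let `Ψ ∈ C¹` be axially `L`-periodic and vanish together with `DΨ` off the cylinder `{ρ < ρ₀}`.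
Then on one period `S = zSlab L 0`, with `eᵢ` the standard basis,
`∫_S P div Ψ = Σᵢ ∫_S ⟪DU eᵢ, DΨ eᵢ⟫ + ∫_S ⟪(U·∇)U, Ψ⟫`.
[cite: BangGuiWangXie2025, Thm 1.4 (c), proof §5 (§2: the Bogovskiĭ-type corrector) (source of the ARGUMENT this module implements; this declaration is the cell’s own lemma or plumbing, NOT a printed statement)] -/
theorem corrector_identity {L : ℝ} (hL : 0 < L)
    {U Ψ : EuclideanSpace ℝ (Fin 3) → EuclideanSpace ℝ (Fin 3)} {P : EuclideanSpace ℝ (Fin 3) → ℝ}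
    (hU : ContDiff ℝ 2 U) (hP : ContDiff ℝ 1 P) (hΨ : ContDiff ℝ 1 Ψ)
    (hNS : ∀ x, convect U U x = (Δ U) x - gradient P x)
    (hUper : IsAxiallyPeriodic L U) (hPper : IsAxiallyPeriodic L P) (hΨper : IsAxiallyPeriodic L Ψ)
    {ρ₀ : ℝ} (hΨ0 : ∀ x, ρ₀ ≤ cylRadius x → Ψ x = 0)
    (hDΨ0 : ∀ x, ρ₀ ≤ cylRadius x → fderiv ℝ Ψ x = 0) :
    ∫ x in zSlab L 0, P x * VectorCalculus.divergence Ψ x =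
      (∑ i, ∫ x in zSlab L 0, ⟪fderiv ℝ U x (EuclideanSpace.basisFun (Fin 3) ℝ i),
          fderiv ℝ Ψ x (EuclideanSpace.basisFun (Fin 3) ℝ i)⟫) +
        ∫ x in zSlab L 0, ⟪convect U U x, Ψ x⟫ := by
  set b := EuclideanSpace.basisFun (Fin 3) ℝ with hb
  set ω2 : ℝ → ℝ := fun s => periodicWindow L s ^ 2 with hω2
  set Φ : EuclideanSpace ℝ (Fin 3) → EuclideanSpace ℝ (Fin 3) := fun x => ω2 (x 2) • Ψ x with hΦ
  set π₂ : EuclideanSpace ℝ (Fin 3) →L[ℝ] ℝ := EuclideanSpace.proj (2 : Fin 3) with hπ₂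
  have hπ₂a : ∀ x : EuclideanSpace ℝ (Fin 3), π₂ x = x 2 := fun x => rfl
  -- regularity
  have hU1 : ContDiff ℝ 1 U := hU.of_le one_le_two
  have hUc : Continuous U := hU1.continuous
  have hPc : Continuous P := hP.continuous
  have hΨc : Continuous Ψ := hΨ.continuous
  have hDUc : Continuous (fderiv ℝ U) := hU1.continuous_fderiv one_ne_zero
  have hDΨc : Continuous (fderiv ℝ Ψ) := hΨ.continuous_fderiv one_ne_zero
  have hΨd : ∀ x, DifferentiableAt ℝ Ψ x := fun x => hΨ.differentiable one_ne_zero x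
  have hω2c : ContDiff ℝ 1 ω2 := contDiff_periodicWindow_sq L
  have hω2d : ∀ s, HasDerivAt ω2 (deriv ω2 s) s := fun s => (hω2c.differentiable one_ne_zero s).hasDerivAt
  have hcω : ContDiff ℝ 1 fun x : EuclideanSpace ℝ (Fin 3) => ω2 (x 2) := hω2c.comp π₂.contDiff
  have hp2 : ∀ x : EuclideanSpace ℝ (Fin 3), HasFDerivAt (fun y : EuclideanSpace ℝ (Fin 3) => y 2) π₂ x :=
    fun x => π₂.hasFDerivAt
  have hcωD : ∀ x : EuclideanSpace ℝ (Fin 3), HasFDerivAt (fun y : EuclideanSpace ℝ (Fin 3) => ω2 (y 2))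
      (deriv ω2 (x 2) • π₂) x := fun x => by
    have h := (hω2d (x 2)).comp_hasFDerivAt x (hp2 x)
    exact h
  have hΦ1 : ContDiff ℝ 1 Φ := hcω.smul hΨ
  -- compact support of the windowed test field
  have hΦzero : ∀ x : EuclideanSpace ℝ (Fin 3), ρ₀ + 2 * L < ‖x‖ → ω2 (x 2) = 0 ∨ Ψ x = 0 := by
    intro x hx
    by_cases hw : ω2 (x 2) = 0
    · exact Or.inl hw
    · right
      have hz := abs_le_of_periodicWindow_sq_ne_zero hL (x 2) hw
      refine hΨ0 x ?_
      by_contra hr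
      have h := norm_le_cylRadius_add_abs_apply_two x
      linarith [not_le.1 hr]
  have hΦc : HasCompactSupport Φ := by
    refine HasCompactSupport.intro (isCompact_closedBall (0 : EuclideanSpace ℝ (Fin 3)) (ρ₀ + 2 * L))
      fun x hx => ?_
    rw [mem_closedBall_zero_iff, not_le] at hx
    rcases hΦzero x hx with h | h
    · simp [hΦ, h]
    · simp [hΦ, h]
  -- derivative and divergence of the windowed field
  have hDΦ : ∀ x v, fderiv ℝ Φ x v = ω2 (x 2) • fderiv ℝ Ψ x v + (deriv ω2 (x 2) * v 2) • Ψ x := by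
    intro x v
    have h : HasFDerivAt Φ (ω2 (x 2) • fderiv ℝ Ψ x + (deriv ω2 (x 2) • π₂).smulRight (Ψ x)) x :=
      (hcωD x).smul (hΨd x).hasFDerivAt
    rw [h.fderiv]
    simp only [_root_.add_apply, _root_.smul_apply, ContinuousLinearMap.smulRight_apply, hπ₂a,
      smul_eq_mul]
  have hdivΦ : ∀ x, VectorCalculus.divergence Φ x =
      ω2 (x 2) * VectorCalculus.divergence Ψ x + deriv ω2 (x 2) * (Ψ x) 2 := by
    intro x
    show VectorCalculus.divergence (fun y => ω2 (y 2) • Ψ y) x = _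
    rw [divergence_smul_apply (hcω.differentiable one_ne_zero x) (hΨd x)]
    congr 1
    rw [real_inner_comm, inner_gradient_left, (hcωD x).fderiv]
    simp only [_root_.smul_apply, hπ₂a, smul_eq_mul]
  -- the whole-space identities
  have hpress := integral_inner_gradient_eq_neg_integral_mul_divergence hP hΦ1 hΦc
  have hgreen := integral_inner_laplacian_add_eq_zero b hU hΦ1 (Or.inr hΦc)
  -- the momentum equation tested against `Φ`
  have hconv_int : Integrable (fun x => ⟪convect U U x, Φ x⟫) :=
    ((hDUc.clm_apply hUc).inner hΦ1.continuous).integrable_of_hasCompactSupport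
      (hΦc.mono fun x hx => by
        rw [Function.mem_support] at hx ⊢
        contrapose! hx
        rw [hx, inner_zero_right])
  have hlap_int : Integrable (fun x => ⟪(Δ U) x, Φ x⟫) :=
    ((continuous_laplacian hU).inner hΦ1.continuous).integrable_of_hasCompactSupport
      (hΦc.mono fun x hx => by
        rw [Function.mem_support] at hx ⊢
        contrapose! hx
        rw [hx, inner_zero_right])
  have hmom : ∫ x, ⟪gradient P x, Φ x⟫ = (∫ x, ⟪(Δ U) x, Φ x⟫) - ∫ x, ⟪convect U U x, Φ x⟫ := by
    rw [← integral_sub hlap_int hconv_int]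
    refine integral_congr_ae (Eventually.of_forall fun x => ?_)
    show ⟪gradient P x, Φ x⟫ = ⟪(Δ U) x, Φ x⟫ - ⟪convect U U x, Φ x⟫
    have e : gradient P x = (Δ U) x - convect U U x := by rw [hNS x]; abel
    rw [e, inner_sub_left]
  -- bookkeeping: (0) pressure densities
  have hdivc : Continuous (VectorCalculus.divergence Ψ) := continuous_divergence hDΨc
  have hdivper : IsAxiallyPeriodic L (VectorCalculus.divergence Ψ) := fun x => by
    show LinearMap.trace ℝ _ _ = LinearMap.trace ℝ _ _
    rw [isAxiallyPeriodic_fderiv hΨper x]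
  have hDΨper : IsAxiallyPeriodic L (fderiv ℝ Ψ) := isAxiallyPeriodic_fderiv hΨper
  have hDUper : IsAxiallyPeriodic L (fderiv ℝ U) := isAxiallyPeriodic_fderiv hUper
  have hdiv0 : ∀ x, ρ₀ ≤ cylRadius x → VectorCalculus.divergence Ψ x = 0 := fun x hx => by
    rw [VectorCalculus.divergence, hDΨ0 x hx]; simp
  obtain ⟨c0, -, i0, -⟩ := window_bookkeeping hL (Q := fun x => P x * VectorCalculus.divergence Ψ x)
    (hPc.mul hdivc) (fun x => by simp only [hPper x, hdivper x]) (ρ := ρ₀)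
    (fun x hx => by rw [hdiv0 x hx, mul_zero])
  obtain ⟨-, c0', -, i0'⟩ := window_bookkeeping hL (Q := fun x => P x * (Ψ x) 2)
    (hPc.mul ((continuous_apply 2).comp ((PiLp.continuous_ofLp 2 _).comp hΨc)))
    (fun x => by simp only [hPper x, hΨper x]) (ρ := ρ₀)
    (fun x hx => by rw [hΨ0 x hx]; simp)
  have e0 : ∫ x, P x * VectorCalculus.divergence Φ x = ∫ x in zSlab L 0, P x * VectorCalculus.divergence Ψ x := by
    rw [← c0, ← add_zero (∫ x, P x * _ * _), ← c0', ← integral_add i0 i0']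
    refine integral_congr_ae (Eventually.of_forall fun x => ?_)
    simp only [hdivΦ]; ring
  -- (1) the Green terms
  have e1 : ∀ i, ∫ x, ⟪fderiv ℝ U x (b i), fderiv ℝ Φ x (b i)⟫ =
      ∫ x in zSlab L 0, ⟪fderiv ℝ U x (b i), fderiv ℝ Ψ x (b i)⟫ := by
    intro i
    obtain ⟨cA, -, iA, -⟩ := window_bookkeeping hL
      (Q := fun x => ⟪fderiv ℝ U x (b i), fderiv ℝ Ψ x (b i)⟫)
      ((hDUc.clm_apply continuous_const).inner (hDΨc.clm_apply continuous_const))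
      (fun x => by simp only [hDUper x, hDΨper x]) (ρ := ρ₀)
      (fun x hx => by rw [hDΨ0 x hx]; simp)
    obtain ⟨-, cB, -, iB⟩ := window_bookkeeping hL
      (Q := fun x => (b i) 2 * ⟪fderiv ℝ U x (b i), Ψ x⟫)
      (continuous_const.mul ((hDUc.clm_apply continuous_const).inner hΨc))
      (fun x => by simp only [hDUper x, hΨper x]) (ρ := ρ₀)
      (fun x hx => by rw [hΨ0 x hx]; simp)
    rw [← cA, ← add_zero (∫ x, ⟪fderiv ℝ U x (b i), fderiv ℝ Ψ x (b i)⟫ * _), ← cB, ← integral_add iA iB]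
    refine integral_congr_ae (Eventually.of_forall fun x => ?_)
    simp only [hDΦ, inner_add_right, real_inner_smul_right]
    ring
  -- (2) the convection term
  have e2 : ∫ x, ⟪convect U U x, Φ x⟫ = ∫ x in zSlab L 0, ⟪convect U U x, Ψ x⟫ := by
    obtain ⟨cA, -, -, -⟩ := window_bookkeeping hL (Q := fun x => ⟪convect U U x, Ψ x⟫)
      ((hDUc.clm_apply hUc).inner hΨc)
      (fun x => by simp only [convect_apply, hDUper x, hUper x, hΨper x]) (ρ := ρ₀)
      (fun x hx => by rw [hΨ0 x hx, inner_zero_right])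
    rw [← cA]
    refine integral_congr_ae (Eventually.of_forall fun x => ?_)
    simp only [hΦ, real_inner_smul_right]
    ring
  -- assemble
  have hfin : ∫ x, P x * VectorCalculus.divergence Φ x =
      (∑ i, ∫ x, ⟪fderiv ℝ U x (b i), fderiv ℝ Φ x (b i)⟫) + ∫ x, ⟪convect U U x, Φ x⟫ := by
    linarith
  rw [e0, e2] at hfin
  simp_rw [e1] at hfin
  exact hfin

/-! ### The stream-function corrector `Ψ = Φ̃ W` -/

/-- **The stream-function corrector** `Ψ(x) = Φ̃(x) W(x)` of radius `r` for the planar field `g`: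
`Φ̃ = streamCorrector g` (bounded potential with angular derivative `⟪x_h, g(x_h)⟫`),
`W = corrField r = J∇φ` (rotation field of the dyadic cut-off).
[cite: BangGuiWangXie2025, Thm 1.4 (c), proof §5 (§2: the Bogovskiĭ-type corrector) (source of the ARGUMENT this module implements; this declaration is the cell’s own lemma or plumbing, NOT a printed statement)] -/
def streamCorrectorField (g : EuclideanSpace ℝ (Fin 3) → EuclideanSpace ℝ (Fin 3)) (r : ℝ)
    (x : EuclideanSpace ℝ (Fin 3)) : EuclideanSpace ℝ (Fin 3) :=
  streamCorrector g x • corrField r x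

/-- The corrector potential only sees the horizontal part: `Φ̃(x + t e₃) = Φ̃(x)`.
[cite: BangGuiWangXie2025, Thm 1.4 (c), proof §5 (§2: the Bogovskiĭ-type corrector) (source of the ARGUMENT this module implements; this declaration is the cell’s own lemma or plumbing, NOT a printed statement)] -/
theorem streamCorrector_add_smul_eZ (g : EuclideanSpace ℝ (Fin 3) → EuclideanSpace ℝ (Fin 3))
    (x : EuclideanSpace ℝ (Fin 3)) (t : ℝ) : streamCorrector g (x + t • eZ) = streamCorrector g x := by
  simp only [streamCorrector, streamPotential, refRadius, horizPart_add_smul_eZ]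

/-- `Ψ` is invariant under axial translations (hence axially periodic of every period).
[cite: BangGuiWangXie2025, Thm 1.4 (c), proof §5 (§2: the Bogovskiĭ-type corrector) (source of the ARGUMENT this module implements; this declaration is the cell’s own lemma or plumbing, NOT a printed statement)] -/
theorem streamCorrectorField_add_smul_eZ (g : EuclideanSpace ℝ (Fin 3) → EuclideanSpace ℝ (Fin 3))
    (r : ℝ) (x : EuclideanSpace ℝ (Fin 3)) (t : ℝ) :
    streamCorrectorField g r (x + t • eZ) = streamCorrectorField g r x := by
  rw [streamCorrectorField, streamCorrectorField, streamCorrector_add_smul_eZ, corrField_add_smul_eZ]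

/-- **Regularity, divergence and bounds of the corrector.** Under the hypotheses of
`hasFDerivAt_streamPotential` (`‖g‖ ≤ G₀`), for `r > 0` with the bounds `‖W‖ ≤ (C/r) χ`,
`‖DW‖ ≤ (C/r²) χ` of `exists_corrField_bounds`: `Ψ = streamCorrectorField g r` is `C¹`, its
divergence is `div Ψ(x) = a(x) ⟪x_h, g(x_h)⟫`, and
`‖Ψ(x)‖ ≤ |Φ̃(x)| (C/r) χ(x)`, `‖DΨ(x)‖ ≤ (2 G₀ C/r + |Φ̃(x)| C/r²) χ(x)`.
[cite: BangGuiWangXie2025, Thm 1.4 (c), proof §5 (§2: the Bogovskiĭ-type corrector) (source of the ARGUMENT this module implements; this declaration is the cell’s own lemma or plumbing, NOT a printed statement)] -/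
theorem streamCorrectorField_props {g : EuclideanSpace ℝ (Fin 3) → EuclideanSpace ℝ (Fin 3)}
    {Dg : EuclideanSpace ℝ (Fin 3) → (EuclideanSpace ℝ (Fin 3) →L[ℝ] EuclideanSpace ℝ (Fin 3))}
    (hg : ∀ y, HasFDerivAt g (Dg y) y) (hDgc : Continuous Dg) {G₀ K : ℝ}
    (hG₀ : ∀ y, ‖g y‖ ≤ G₀) (hK : ∀ y, ‖Dg y‖ ≤ K)
    (htr : ∀ y, Dg y (EuclideanSpace.single 0 1) 0 + Dg y (EuclideanSpace.single 1 1) 1 = 0)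
    {r C : ℝ} (hr : 0 < r) (hC : 0 ≤ C)
    (hW : ∀ x, ‖corrField r x‖ ≤
      C / r * {x | r ≤ cylRadius x ∧ cylRadius x < 2 * r}.indicator (fun _ => (1 : ℝ)) x)
    (hDW : ∀ x, ‖fderiv ℝ (corrField r) x‖ ≤
      C / r ^ 2 * {x | r ≤ cylRadius x ∧ cylRadius x < 2 * r}.indicator (fun _ => (1 : ℝ)) x) :
    ContDiff ℝ 1 (streamCorrectorField g r) ∧
      (∀ x, VectorCalculus.divergence (streamCorrectorField g r) x =
        dyCoeff r x * ⟪horizPart x, g (horizPart x)⟫) ∧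
      (∀ x, ‖streamCorrectorField g r x‖ ≤ |streamCorrector g x| * (C / r) *
        {x | r ≤ cylRadius x ∧ cylRadius x < 2 * r}.indicator (fun _ => (1 : ℝ)) x) ∧
      ∀ x, ‖fderiv ℝ (streamCorrectorField g r) x‖ ≤
        (2 * G₀ * (C / r) + |streamCorrector g x| * (C / r ^ 2)) *
          {x | r ≤ cylRadius x ∧ cylRadius x < 2 * r}.indicator (fun _ => (1 : ℝ)) x := by
  set Φt := streamCorrector g with hΦt
  set W := corrField r with hWdef
  set χ := {x | r ≤ cylRadius x ∧ cylRadius x < 2 * r}.indicator (fun _ => (1 : ℝ)) with hχ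
  have hχnn : ∀ x, 0 ≤ χ x := fun x => Set.indicator_nonneg (fun _ _ => zero_le_one) x
  obtain ⟨hΦd, hΦc, hΦb, hΦang⟩ := streamCorrector_deriv hg hDgc hG₀ hK htr
  have hΦ1 : ContDiff ℝ 1 Φt := contDiff_one_iff_fderiv.2 ⟨hΦd, hΦc⟩
  have hW1 : ContDiff ℝ 1 W := contDiff_corrField r
  have hWd : ∀ x, DifferentiableAt ℝ W x := fun x => hW1.differentiable one_ne_zero x
  have hG₀0 : 0 ≤ G₀ := (norm_nonneg _).trans (hG₀ 0)
  have hDΨ : ∀ x v, fderiv ℝ (streamCorrectorField g r) x v =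
      (fderiv ℝ Φt x v) • W x + Φt x • fderiv ℝ W x v := by
    intro x v
    have h : HasFDerivAt (streamCorrectorField g r)
        (Φt x • fderiv ℝ W x + (fderiv ℝ Φt x).smulRight (W x)) x :=
      (hΦd x).hasFDerivAt.smul (hWd x).hasFDerivAt
    rw [h.fderiv]
    simp only [_root_.add_apply, _root_.smul_apply, ContinuousLinearMap.smulRight_apply]
    rw [add_comm]
  refine ⟨hΦ1.smul hW1, fun x => ?_, fun x => ?_, fun x => ?_⟩
  · -- divergence
    show VectorCalculus.divergence (fun y => Φt y • W y) x = _
    rw [divergence_smul_apply (hΦd x) (hWd x), hWdef, divergence_corrField, mul_zero, zero_add,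
      real_inner_comm, inner_gradient_left, corrField, map_smul, smul_eq_mul, hΦang x]
  · -- size
    show ‖Φt x • W x‖ ≤ _
    rw [norm_smul, Real.norm_eq_abs, mul_assoc]
    exact mul_le_mul_of_nonneg_left (hW x) (abs_nonneg _)
  · -- derivative
    refine ContinuousLinearMap.opNorm_le_bound _ (mul_nonneg (by positivity) (hχnn x)) fun v => ?_
    rw [hDΨ x v]
    have h1 : ‖fderiv ℝ Φt x v • W x‖ ≤ 2 * G₀ * (C / r) * χ x * ‖v‖ := by
      rw [norm_smul, Real.norm_eq_abs]
      have ha : |fderiv ℝ Φt x v| ≤ 2 * G₀ * ‖v‖ := by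
        rw [← Real.norm_eq_abs]
        exact (ContinuousLinearMap.le_opNorm _ _).trans (mul_le_mul_of_nonneg_right (hΦb x) (norm_nonneg _))
      calc |fderiv ℝ Φt x v| * ‖W x‖ ≤ (2 * G₀ * ‖v‖) * (C / r * χ x) :=
            mul_le_mul ha (hW x) (norm_nonneg _) (by positivity)
        _ = 2 * G₀ * (C / r) * χ x * ‖v‖ := by ring
    have h2 : ‖Φt x • fderiv ℝ W x v‖ ≤ |Φt x| * (C / r ^ 2) * χ x * ‖v‖ := by
      rw [norm_smul, Real.norm_eq_abs]
      have hb : ‖fderiv ℝ W x v‖ ≤ C / r ^ 2 * χ x * ‖v‖ :=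
        (ContinuousLinearMap.le_opNorm _ _).trans (mul_le_mul_of_nonneg_right (hDW x) (norm_nonneg _))
      calc |Φt x| * ‖fderiv ℝ W x v‖ ≤ |Φt x| * (C / r ^ 2 * χ x * ‖v‖) :=
            mul_le_mul_of_nonneg_left hb (abs_nonneg _)
        _ = |Φt x| * (C / r ^ 2) * χ x * ‖v‖ := by ring
    calc ‖fderiv ℝ Φt x v • W x + Φt x • fderiv ℝ W x v‖
        ≤ ‖fderiv ℝ Φt x v • W x‖ + ‖Φt x • fderiv ℝ W x v‖ := norm_add_le _ _
      _ ≤ 2 * G₀ * (C / r) * χ x * ‖v‖ + |Φt x| * (C / r ^ 2) * χ x * ‖v‖ := add_le_add h1 h2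
      _ = (2 * G₀ * (C / r) + |Φt x| * (C / r ^ 2)) * χ x * ‖v‖ := by ring

end Literature.Analysis.SteadySlabLiouville.PeriodicSlab

end Part1

/-!
## Part 2 — port of `Summits/NavierStokesRegularity/NavierStokesRegularity/Theorems/ScenarioCensusPeriodicSlabDecayMean.lean` (3 declarations kept)

# Census row S7 (c): the vertical period mean and the bound for the corrector pressure term

Support file for the scenario census of `NavierStokesRegularity` (cell `pub/ns-census`, block S,
row S7 = Bang–Gui–Wang–Xie, J. Fluid Mech. 1005 (2025) A6 = arXiv:2205.13259, Thm 1.4 (c)). In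
the Saint-Venant estimate for case (c) (§5 Step 3) the cut-off pressure term `∫ P u^r φ'` is
split along `u^r = (u^r − ū^r) + ū^r`, `ū^r` the vertical period mean; the mean-free part is
handled as in rows S6 / S7 (a)(b) (foot-point splitting), the mean part through the corrector
`Ψ = Φ̃ J∇φ` of `…PeriodicSlabCorrector` with `div Ψ = a ⟪x_h, g⟫`,
`g = ∫₀ᴸ U(· + s e₃) ds`:

* `verticalIntegral_props` — `g` is `C¹` with `Dg = ∫₀ᴸ DU(· + s e₃) ds` continuous,
  `‖g‖ ≤ M L`, `‖Dg‖ ≤ K₁ L`, horizontal trace of `Dg` zero (from `div U = 0`, `∂₃ g = 0`),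
  `z`-invariant, and `⟪x_h, g x⟫ = ∫₀ᴸ ⟪x_h, U(x + s e₃)⟫ ds`;
* `corrector_pressure_bound` — for a smooth bounded axially periodic steady flow at unit
  viscosity with `|⟪x_h, U⟫| ≤ ε ≤ 1` off the cylinder `{ρ < r}` (`r ≥ 1`):
  `|∫_S P a ⟪x_h, g⟫| ≤ L (a₃ λ r + c₃ (∫_S χ|DU|²)/(λ r))` for every `λ > 0`, with `a₃, c₃`
  depending only on `sup ‖U‖`, `L` and the cut-off constant — the printed (4-27)/(4-36)/(4-37)
  with `R u^r` bounded, here WITHOUT the Bogovskiĭ operator.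

No summit statement and no census row is proved in this file.

## References

* J. Bang, C. Gui, Y. Wang, C. Xie, arXiv:2205.13259, §5 Step 3, (4-19)–(4-37).
  [BangGuiWangXie2025]
-/

section Part2

open _root_.MeasureTheory _root_.Set _root_.Function _root_.Filter _root_.InnerProductSpace
open scoped _root_.Topology _root_.ENNReal _root_.NNReal RealInnerProductSpace Laplacian _root_.ContDiff

namespace Literature.Analysis.SteadySlabLiouville.PeriodicSlab

open Literature.Analysis Literature.Analysis.FluidPDE
open Literature.Analysis.SteadySlabLiouville.HelicalSlab

/-! ### The vertical period mean `g = ∫₀ᴸ U(· + s e₃) ds` -/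

/-- **The vertical period integral of a bounded divergence-free periodic field.** Let
`U ∈ C¹(ℝ³; ℝ³)` with `‖U‖ ≤ M`, `‖DU‖ ≤ K₁`, `div U = 0`, axially `L`-periodic (`L > 0`), and
`g(y) = ∫₀ᴸ U(y + s e₃) ds`, `Dg(y) = ∫₀ᴸ DU(y + s e₃) ds`. Then `g` has derivative `Dg`
everywhere, `Dg` is continuous, `‖g‖ ≤ M L`, `‖Dg‖ ≤ K₁ L`, the horizontal trace of `Dg`
vanishes, `g` is invariant under axial translations, and `⟪x_h, g x⟫ = ∫₀ᴸ ⟪x_h, U(x + s e₃)⟫ ds`.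
[cite: BangGuiWangXie2025, Thm 1.4 (c), proof §5 (§2: the Bogovskiĭ-type corrector) (source of the ARGUMENT this module implements; this declaration is the cell’s own lemma or plumbing, NOT a printed statement)] -/
theorem verticalIntegral_props {L M K₁ : ℝ} (hL : 0 < L)
    {U : EuclideanSpace ℝ (Fin 3) → EuclideanSpace ℝ (Fin 3)} (hU : ContDiff ℝ 1 U)
    (hM : ∀ x, ‖U x‖ ≤ M) (hK₁ : ∀ x, ‖fderiv ℝ U x‖ ≤ K₁) (hdiv : VectorCalculus.IsDivFree U)
    (hper : IsAxiallyPeriodic L U) :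
    (∀ y, HasFDerivAt (fun y => ∫ s in (0 : ℝ)..L, U (y + s • eZ))
        (∫ s in (0 : ℝ)..L, fderiv ℝ U (y + s • eZ)) y) ∧
      (Continuous fun y => ∫ s in (0 : ℝ)..L, fderiv ℝ U (y + s • eZ)) ∧
      (∀ y, ‖∫ s in (0 : ℝ)..L, U (y + s • eZ)‖ ≤ M * L) ∧
      (∀ y, ‖∫ s in (0 : ℝ)..L, fderiv ℝ U (y + s • eZ)‖ ≤ K₁ * L) ∧
      (∀ y, (∫ s in (0 : ℝ)..L, fderiv ℝ U (y + s • eZ)) (EuclideanSpace.single 0 1) 0 +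
          (∫ s in (0 : ℝ)..L, fderiv ℝ U (y + s • eZ)) (EuclideanSpace.single 1 1) 1 = 0) ∧
      (∀ (y : EuclideanSpace ℝ (Fin 3)) (t : ℝ),
          (∫ s in (0 : ℝ)..L, U (y + t • eZ + s • eZ)) = ∫ s in (0 : ℝ)..L, U (y + s • eZ)) ∧
      ∀ y, ⟪horizPart y, ∫ s in (0 : ℝ)..L, U (y + s • eZ)⟫ =
          ∫ s in (0 : ℝ)..L, ⟪horizPart y, U (y + s • eZ)⟫ := by
  have hUc : Continuous U := hU.continuous
  have hDUc : Continuous (fderiv ℝ U) := hU.continuous_fderiv one_ne_zero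
  have hline : ∀ y : EuclideanSpace ℝ (Fin 3), Continuous fun s : ℝ => y + s • (eZ : EuclideanSpace ℝ (Fin 3)) :=
    fun y => continuous_const.add (continuous_id.smul continuous_const)
  set g : EuclideanSpace ℝ (Fin 3) → EuclideanSpace ℝ (Fin 3) := fun y => ∫ s in (0 : ℝ)..L, U (y + s • eZ)
    with hg
  set Dg : EuclideanSpace ℝ (Fin 3) → (EuclideanSpace ℝ (Fin 3) →L[ℝ] EuclideanSpace ℝ (Fin 3)) :=
    fun y => ∫ s in (0 : ℝ)..L, fderiv ℝ U (y + s • eZ) with hDg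
  have hgD : ∀ y, HasFDerivAt g (Dg y) y := fun y => hasFDerivAt_verticalIntegral hU hK₁ y
  have hgd : Differentiable ℝ g := fun y => (hgD y).differentiableAt
  have hgF : ∀ y, fderiv ℝ g y = Dg y := fun y => (hgD y).fderiv
  have hDint : ∀ y, IntervalIntegrable (fun s : ℝ => fderiv ℝ U (y + s • eZ)) volume 0 L :=
    fun y => (hDUc.comp (hline y)).intervalIntegrable _ _
  have hDgc : Continuous Dg := by
    have h := intervalIntegral.continuous_parametric_intervalIntegral_of_continuous'
      (μ := volume) (f := fun (y : EuclideanSpace ℝ (Fin 3)) (s : ℝ) => fderiv ℝ U (y + s • eZ))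
      (by exact hDUc.comp (continuous_fst.add (continuous_snd.smul continuous_const))) 0 L
    exact h
  have hgz : ∀ (y : EuclideanSpace ℝ (Fin 3)) (t : ℝ), g (y + t • eZ) = g y :=
    fun y t => verticalIntegral_add_smul_eZ hper y t
  -- norms
  have hG₀ : ∀ y, ‖g y‖ ≤ M * L := fun y => by
    have h := intervalIntegral.norm_integral_le_of_norm_le_const (a := 0) (b := L)
      (f := fun s : ℝ => U (y + s • eZ)) (C := M) fun s _ => hM _
    rwa [sub_zero, abs_of_pos hL] at h
  have hK : ∀ y, ‖Dg y‖ ≤ K₁ * L := fun y => by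
    have h := intervalIntegral.norm_integral_le_of_norm_le_const (a := 0) (b := L)
      (f := fun s : ℝ => fderiv ℝ U (y + s • eZ)) (C := K₁) fun s _ => hK₁ _
    rwa [sub_zero, abs_of_pos hL] at h
  -- divergence and the axial column
  set τ : (EuclideanSpace ℝ (Fin 3) →L[ℝ] EuclideanSpace ℝ (Fin 3)) →L[ℝ] ℝ :=
    LinearMap.toContinuousLinearMap
      ((LinearMap.trace ℝ (EuclideanSpace ℝ (Fin 3))).comp (ContinuousLinearMap.coeLM ℝ)) with hτ
  have hτ_apply : ∀ T : EuclideanSpace ℝ (Fin 3) →L[ℝ] EuclideanSpace ℝ (Fin 3),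
      τ T = LinearMap.trace ℝ _ (T : EuclideanSpace ℝ (Fin 3) →ₗ[ℝ] EuclideanSpace ℝ (Fin 3)) :=
    fun T => rfl
  have hdivg : ∀ y, VectorCalculus.divergence g y = 0 := fun y => by
    rw [VectorCalculus.divergence, hgF y, ← hτ_apply, hDg, ← τ.intervalIntegral_comp_comm (hDint y)]
    have : (fun s : ℝ => τ (fderiv ℝ U (y + s • eZ))) = fun _ => (0 : ℝ) := by
      funext s
      rw [hτ_apply]
      exact hdiv (y + s • eZ)
    rw [this, intervalIntegral.integral_const, smul_zero]
  have hDg_eZ : ∀ y, fderiv ℝ g y eZ = 0 := fun y => by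
    have h1 : HasDerivAt (fun t : ℝ => g (y + t • eZ)) (fderiv ℝ g (y + (0 : ℝ) • eZ) eZ) 0 :=
      hasDerivAt_comp_add_smul_eZ hgd y 0
    have h2 : (fun t : ℝ => g (y + t • eZ)) = fun _ => g y := funext fun t => hgz y t
    rw [h2, zero_smul, add_zero] at h1
    exact h1.unique (hasDerivAt_const (0 : ℝ) (g y))
  set b := EuclideanSpace.basisFun (Fin 3) ℝ with hb
  have htr : ∀ y, Dg y (EuclideanSpace.single 0 1) 0 + Dg y (EuclideanSpace.single 1 1) 1 = 0 := by
    intro y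
    have hb0 : b 0 = EuclideanSpace.single 0 (1 : ℝ) := by simp [hb]
    have hb1 : b 1 = EuclideanSpace.single 1 (1 : ℝ) := by simp [hb]
    have hb2 : b 2 = EuclideanSpace.single 2 (1 : ℝ) := by simp [hb]
    have htr3 : ⟪b 0, Dg y (b 0)⟫ + ⟪b 1, Dg y (b 1)⟫ + ⟪b 2, Dg y (b 2)⟫ = 0 := by
      have h := divergence_eq_sum_inner_fderiv b g y
      rw [hdivg y, Fin.sum_univ_three, hgF y] at h
      linarith
    have hcol : Dg y (b 2) = 0 := by rw [hb2, ← hgF y]; exact hDg_eZ y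
    rw [hcol, inner_zero_right, add_zero, hb0, hb1] at htr3
    simpa [EuclideanSpace.inner_single_left] using htr3
  have hrepr : ∀ y, ⟪horizPart y, g y⟫ = ∫ s in (0 : ℝ)..L, ⟪horizPart y, U (y + s • eZ)⟫ := by
    intro y
    show innerSL ℝ (horizPart y) (∫ s in (0 : ℝ)..L, U (y + s • eZ)) = _
    have hint : IntervalIntegrable (fun s : ℝ => U (y + s • eZ)) volume 0 L :=
      (hUc.comp (hline y)).intervalIntegrable _ _
    rw [← (innerSL ℝ (horizPart y)).intervalIntegral_comp_comm hint]
    simp only [innerSL_apply_apply]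
  exact ⟨hgD, hDgc, hG₀, hK, htr, hgz, hrepr⟩

/-! ### The corrector pressure term -/

/-- Young: `y ≤ (μ + y²/μ)/2` for `μ > 0` (local copy of the elementary step).
[cite: BangGuiWangXie2025, Thm 1.4 (c), proof §5 (§2: the Bogovskiĭ-type corrector) (source of the ARGUMENT this module implements; this declaration is the cell’s own lemma or plumbing, NOT a printed statement)] -/
theorem young_le_half (y : ℝ) {μ : ℝ} (hμ : 0 < μ) : y ≤ (μ + y ^ 2 / μ) / 2 :=
  (le_abs_self y).trans (young_abs_le y hμ)

/-- **The corrector pressure term is of Saint-Venant size.** Let `(U, P)` be a smooth steady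
solution at unit viscosity (`IsLerayProfile 1 0 U P`, `U, P ∈ C^∞`), both axially `L`-periodic
(`L > 0`), with `‖U‖ ≤ M`, `‖DU‖ ≤ K₁`, `|DU|² ≤ B`; let `r ≥ 1`, `χ = 𝟙{r ≤ ρ < 2r}`, and let
`C ≥ 0` bound the dyadic cut-off coefficient and rotation field as in `exists_corrField_bounds`.
If `|⟪x_h, U x⟫| ≤ ε` for all `x` with `ρ(x) ≥ r`, `ε ≤ 1`, then for every `λ > 0`, with
`g = ∫₀ᴸ U(· + s e₃) ds` and `D = ∫_S χ |DU|²` (`S = zSlab L 0`):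
`|∫_S P a ⟪x_h, g⟫| ≤ L ((48 C L (3M + π) + 16 C L M (π + M)) λ r + ((3/2) C (3M + π) + (1/2) C M (π + M)) D/(λ r))`.
[cite: BangGuiWangXie2025, Thm 1.4 (c), proof §5 (§2: the Bogovskiĭ-type corrector) (source of the ARGUMENT this module implements; this declaration is the cell’s own lemma or plumbing, NOT a printed statement)] -/
theorem corrector_pressure_bound {L M K₁ B C r lam ε : ℝ} (hL : 0 < L)
    {U : EuclideanSpace ℝ (Fin 3) → EuclideanSpace ℝ (Fin 3)} {P : EuclideanSpace ℝ (Fin 3) → ℝ}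
    (h : IsLerayProfile 1 0 U P) (hU : ContDiff ℝ (⊤ : ℕ∞) U) (hP : ContDiff ℝ (⊤ : ℕ∞) P)
    (hUper : IsAxiallyPeriodic L U) (hPper : IsAxiallyPeriodic L P)
    (hM : ∀ x, ‖U x‖ ≤ M) (hK₁ : ∀ x, ‖fderiv ℝ U x‖ ≤ K₁)
    (hB : ∀ x, frobeniusNormSq (fderiv ℝ U x) ≤ B) (hC0 : 0 ≤ C)
    (hW : ∀ x, ‖corrField r x‖ ≤
      C / r * {x | r ≤ cylRadius x ∧ cylRadius x < 2 * r}.indicator (fun _ => (1 : ℝ)) x)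
    (hDW : ∀ x, ‖fderiv ℝ (corrField r) x‖ ≤
      C / r ^ 2 * {x | r ≤ cylRadius x ∧ cylRadius x < 2 * r}.indicator (fun _ => (1 : ℝ)) x)
    (hr : 1 ≤ r) (hlam : 0 < lam) (hε1 : ε ≤ 1)
    (hdec : ∀ x, r ≤ cylRadius x → |⟪horizPart x, U x⟫| ≤ ε) :
    |∫ x in zSlab L 0, P x * (dyCoeff r x * ⟪horizPart x, ∫ s in (0 : ℝ)..L, U (x + s • eZ)⟫)| ≤
      L * ((48 * C * L * (3 * M + Real.pi) + 16 * C * L * M * (Real.pi + M)) * lam * r +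
        (3 / 2 * C * (3 * M + Real.pi) + 1 / 2 * C * M * (Real.pi + M)) *
          (∫ x in zSlab L 0,
            {x | r ≤ cylRadius x ∧ cylRadius x < 2 * r}.indicator (fun _ => (1 : ℝ)) x *
              frobeniusNormSq (fderiv ℝ U x)) / (lam * r)) := by
  set b := EuclideanSpace.basisFun (Fin 3) ℝ with hb
  set S : Set (EuclideanSpace ℝ (Fin 3)) := zSlab L 0 with hS
  set F : EuclideanSpace ℝ (Fin 3) → ℝ := fun x => frobeniusNormSq (fderiv ℝ U x) with hF
  set A : Set (EuclideanSpace ℝ (Fin 3)) := {x | r ≤ cylRadius x ∧ cylRadius x < 2 * r} with hA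
  set χ : EuclideanSpace ℝ (Fin 3) → ℝ := A.indicator fun _ => (1 : ℝ) with hχ
  have hr0 : 0 < r := by linarith
  have hM0 : 0 ≤ M := (norm_nonneg _).trans (hM 0)
  have hU1 : ContDiff ℝ 1 U := contDiff_infty.1 hU 1
  have hU2 : ContDiff ℝ 2 U := contDiff_infty.1 hU 2
  have hP1 : ContDiff ℝ 1 P := contDiff_infty.1 hP 1
  have hUc : Continuous U := hU1.continuous
  have hDUc : Continuous (fderiv ℝ U) := hU1.continuous_fderiv one_ne_zero
  have hFc : Continuous F := continuous_frobeniusNormSq_fderiv hU1 one_ne_zero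
  have hF0 : ∀ x, 0 ≤ F x := fun x => frobeniusNormSq_nonneg _
  have hdi : ∀ x i, ‖fderiv ℝ U x (b i)‖ ^ 2 ≤ F x := fun x i => norm_apply_sq_le_frobeniusNormSq b _ i
  have hop : ∀ x, ‖fderiv ℝ U x‖ ^ 2 ≤ F x := fun x => sq_opNorm_le_frobeniusNormSq _
  have hAm : MeasurableSet A :=
    (isClosed_le continuous_const continuous_cylRadius).measurableSet.inter
      (isOpen_lt continuous_cylRadius continuous_const).measurableSet
  have hχm : Measurable χ := measurable_const.indicator hAm
  have hχnn : ∀ x, 0 ≤ χ x := fun x => Set.indicator_nonneg (fun _ _ => zero_le_one) x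
  have hχle : ∀ x, χ x ≤ 1 := fun x => Set.indicator_le_self' (fun _ _ => zero_le_one) x
  have hχzero : ∀ x, 2 * r ≤ cylRadius x → χ x = 0 := fun x hx => by
    simp only [hχ, Set.indicator_apply, hA, mem_setOf_eq]
    rw [if_neg]; exact fun h' => absurd h'.2 (not_lt.2 hx)
  have hχA : ∀ x, x ∈ A → χ x = 1 := fun x hx => by simp [hχ, hx]
  have hχA' : ∀ x, x ∉ A → χ x = 0 := fun x hx => by simp [hχ, hx]
  -- the vertical period mean
  obtain ⟨hgD, hDgc, hG₀, hK, htr, hgz, hrepr⟩ := verticalIntegral_props hL hU1 hM hK₁ h.divFree hUper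
  set g : EuclideanSpace ℝ (Fin 3) → EuclideanSpace ℝ (Fin 3) := fun y => ∫ s in (0 : ℝ)..L, U (y + s • eZ)
    with hgdef
  have hgh : ∀ x, g (horizPart x) = g x := fun x => by
    have e : horizPart x = x + (-(x 2)) • eZ := by
      rw [horizPart_apply, sub_eq_add_neg, neg_smul]
    rw [e]; exact hgz x _
  -- the radial flux of `g` is small off the cylinder `{ρ < r}`
  have hflux : ∀ y, r ≤ cylRadius y → |⟪horizPart y, g y⟫| ≤ L * ε := by
    intro y hy
    rw [hrepr y]
    have h1 := intervalIntegral.norm_integral_le_of_norm_le_const (a := 0) (b := L)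
      (f := fun s : ℝ => ⟪horizPart y, U (y + s • eZ)⟫) (C := ε) fun s _ => by
        rw [Real.norm_eq_abs, ← horizPart_add_smul_eZ y s]
        refine hdec _ ?_
        have : cylRadius (y + s • eZ) = cylRadius y := by simp [cylRadius, eZ]
        rw [this]; exact hy
    rw [sub_zero, abs_of_pos hL, Real.norm_eq_abs] at h1
    linarith
  -- the corrector potential on the annulus: `|Φ̃| ≤ π L ε + M L ≤ L (π + M)`
  have hΦA : ∀ x, x ∈ A → |streamCorrector g x| ≤ L * (Real.pi + M) := by
    intro x hx
    have hx0 : 0 < cylRadius x := lt_of_lt_of_le hr0 hx.1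
    have h1 := abs_streamCorrector_le hgD hDgc hG₀ hK htr hx0 (N := L * ε) fun y _ hy =>
      hflux y (by rw [hy]; exact hx.1)
    have h2 : Real.pi * (L * ε) ≤ Real.pi * L := by
      have : L * ε ≤ L * 1 := mul_le_mul_of_nonneg_left hε1 hL.le
      rw [mul_one] at this
      exact mul_le_mul_of_nonneg_left this Real.pi_pos.le
    calc |streamCorrector g x| ≤ Real.pi * (L * ε) + M * L := h1
      _ ≤ L * (Real.pi + M) := by nlinarith
  -- the corrector field and its bounds
  obtain ⟨hΨ1, hdivΨ, hΨb, hDΨb⟩ := streamCorrectorField_props hgD hDgc hG₀ hK htr hr0 hC0 hW hDW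
  set Ψ := streamCorrectorField g r with hΨdef
  have hΨn : ∀ x, ‖Ψ x‖ ≤ L * (Real.pi + M) * C / r * χ x := by
    intro x
    by_cases hx : x ∈ A
    · have h1 := hΨb x
      rw [← hχ] at h1
      rw [hχA x hx, mul_one] at h1 ⊢
      calc ‖Ψ x‖ ≤ |streamCorrector g x| * (C / r) := h1
        _ ≤ L * (Real.pi + M) * (C / r) := mul_le_mul_of_nonneg_right (hΦA x hx) (by positivity)
        _ = L * (Real.pi + M) * C / r := by ring
    · have h1 := hΨb x
      rw [← hχ] at h1
      rw [hχA' x hx, mul_zero] at h1 ⊢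
      exact h1
  have hDΨn : ∀ x, ‖fderiv ℝ Ψ x‖ ≤ L * C * (3 * M + Real.pi) / r * χ x := by
    intro x
    by_cases hx : x ∈ A
    · have h1 := hDΨb x
      rw [← hχ] at h1
      rw [hχA x hx, mul_one] at h1 ⊢
      have h2 : |streamCorrector g x| * (C / r ^ 2) ≤ L * (Real.pi + M) * (C / r) := by
        have h3 : C / r ^ 2 ≤ C / r := by
          rw [div_le_div_iff₀ (by positivity) hr0]
          calc C * r = C * r * 1 := by ring
            _ ≤ C * r * r := mul_le_mul_of_nonneg_left hr (by positivity)
            _ = C * r ^ 2 := by ring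
        exact mul_le_mul (hΦA x hx) h3 (by positivity) (by positivity)
      calc ‖fderiv ℝ Ψ x‖ ≤ 2 * (M * L) * (C / r) + |streamCorrector g x| * (C / r ^ 2) := h1
        _ ≤ 2 * (M * L) * (C / r) + L * (Real.pi + M) * (C / r) := by linarith
        _ = L * C * (3 * M + Real.pi) / r := by ring
    · have h1 := hDΨb x
      rw [← hχ] at h1
      rw [hχA' x hx, mul_zero] at h1 ⊢
      exact h1
  have hΨ0 : ∀ x, 2 * r ≤ cylRadius x → Ψ x = 0 := fun x hx => by
    have h1 := hΨn x
    rw [hχzero x hx, mul_zero] at h1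
    exact norm_eq_zero.1 (le_antisymm h1 (norm_nonneg _))
  have hDΨ0 : ∀ x, 2 * r ≤ cylRadius x → fderiv ℝ Ψ x = 0 := fun x hx => by
    have h1 := hDΨn x
    rw [hχzero x hx, mul_zero] at h1
    exact norm_eq_zero.1 (le_antisymm h1 (norm_nonneg _))
  have hΨper : IsAxiallyPeriodic L Ψ := fun x => streamCorrectorField_add_smul_eZ g r x L
  -- the momentum equation at unit viscosity
  have hNS : ∀ x, convect U U x = (Δ U) x - gradient P x := fun x => by
    have e := h.profile_eq x
    simp only [one_smul, zero_smul, add_zero] at e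
    rw [← sub_eq_zero]
    rw [← e]
    abel
  -- the corrector identity
  have hid := corrector_identity hL hU2 hP1 hΨ1 hNS hUper hPper hΨper hΨ0 hDΨ0
  have hJ : ∫ x in S, P x * (dyCoeff r x * ⟪horizPart x, g x⟫) =
      ∫ x in S, P x * VectorCalculus.divergence Ψ x := by
    refine setIntegral_congr_fun (measurableSet_zSlab L 0) fun x _ => ?_
    rw [hdivΨ x, hgh x]
  -- integrability of the dominating functions
  have hχ_int : IntegrableOn χ S volume :=
    integrableOn_zSlab_of_bound hL hχm.aestronglyMeasurable (ρ := 2 * r) hχzero (B := 1)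
      fun x _ => by rw [Real.norm_eq_abs, abs_of_nonneg (hχnn x)]; exact hχle x
  have hB0 : 0 ≤ B := (hF0 0).trans (hB 0)
  have hD_int : IntegrableOn (fun x => χ x * F x) S volume := by
    refine integrableOn_zSlab_of_bound hL ((hχm.mul hFc.measurable).aestronglyMeasurable)
      (ρ := 2 * r) (fun x hx => by rw [hχzero x hx, zero_mul]) (B := B) fun x _ => ?_
    rw [Real.norm_eq_abs, abs_mul, abs_of_nonneg (hχnn x), abs_of_nonneg (hF0 x)]
    exact (mul_le_mul (hχle x) (hB x) (hF0 x) zero_le_one).trans (by rw [one_mul])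
  set V : ℝ := ∫ x in S, χ x with hVdef
  set D : ℝ := ∫ x in S, χ x * F x with hD
  have hD0 : 0 ≤ D := setIntegral_nonneg (measurableSet_zSlab L 0) fun x _ => mul_nonneg (hχnn x) (hF0 x)
  have hV : V ≤ 32 * L * r ^ 2 := by
    have h1 : V = volume.real (S ∩ A) := by
      rw [hVdef, hχ, setIntegral_indicator hAm, setIntegral_const, smul_eq_mul, mul_one]
    rw [h1, measureReal_def]
    refine ENNReal.toReal_le_of_le_ofReal (by positivity) ?_
    calc volume (S ∩ A) ≤ volume (zSlab L 0 ∩ {x | cylRadius x < 2 * r}) :=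
          measure_mono fun x hx => ⟨hx.1, hx.2.2⟩
      _ ≤ ENNReal.ofReal (8 * L * (2 * r) ^ 2) := volume_zSlab_inter_cyl_le hL (by linarith)
      _ = ENNReal.ofReal (32 * L * r ^ 2) := by ring_nf
  -- the generic `χ`-weighted bound: `|q| ≤ (c/r) χ ‖DU‖-type` ⇒ `|∫ q| ≤ 16 c L λ r + c D/(2 λ r)`
  have hgen : ∀ c : ℝ, 0 ≤ c → ∀ q : EuclideanSpace ℝ (Fin 3) → ℝ, IntegrableOn q S volume →
      ∀ n : EuclideanSpace ℝ (Fin 3) → ℝ, (∀ x, 0 ≤ n x) → (∀ x, n x ^ 2 ≤ F x) →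
      (∀ x, |q x| ≤ c / r * χ x * n x) →
      |∫ x in S, q x| ≤ 16 * c * L * lam * r + c / 2 * D / (lam * r) := by
    intro c hc q hqi n hn0 hnF hqb
    have hdom_int : IntegrableOn (fun x => c * lam / (2 * r) * χ x + c / (2 * r * lam) * (χ x * F x)) S volume :=
      (hχ_int.const_mul _).add (hD_int.const_mul _)
    have h1 := norm_integral_le_of_norm_le (μ := volume.restrict S) hdom_int
      (Eventually.of_forall fun x => (?_ :
        ‖q x‖ ≤ c * lam / (2 * r) * χ x + c / (2 * r * lam) * (χ x * F x)))
    · rw [Real.norm_eq_abs] at h1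
      have h2 : ∫ x in S, (c * lam / (2 * r) * χ x + c / (2 * r * lam) * (χ x * F x)) =
          c * lam / (2 * r) * V + c / (2 * r * lam) * D := by
        rw [integral_add (hχ_int.const_mul _) (hD_int.const_mul _), integral_const_mul, integral_const_mul]
      rw [h2] at h1
      have h3 : c * lam / (2 * r) * V ≤ c * lam / (2 * r) * (32 * L * r ^ 2) :=
        mul_le_mul_of_nonneg_left hV (by positivity)
      have e : c * lam / (2 * r) * (32 * L * r ^ 2) + c / (2 * r * lam) * D =
          16 * c * L * lam * r + c / 2 * D / (lam * r) := by
        field_simp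
        ring
      linarith
    · rw [Real.norm_eq_abs]
      have hy := young_le_half (n x) hlam
      have hy' : n x ≤ (lam + F x / lam) / 2 :=
        hy.trans (by have := div_le_div_of_nonneg_right (hnF x) hlam.le; linarith)
      have h5 : 0 ≤ c / r * χ x := mul_nonneg (div_nonneg hc hr0.le) (hχnn x)
      calc |q x| ≤ c / r * χ x * n x := hqb x
        _ ≤ c / r * χ x * ((lam + F x / lam) / 2) := mul_le_mul_of_nonneg_left hy' h5
        _ = c * lam / (2 * r) * χ x + c / (2 * r * lam) * (χ x * F x) := by
            field_simp
  -- the Green–corrector terms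
  have hGreen : ∀ i, |∫ x in S, ⟪fderiv ℝ U x (b i), fderiv ℝ Ψ x (b i)⟫| ≤
      16 * (L * C * (3 * M + Real.pi)) * L * lam * r + (L * C * (3 * M + Real.pi)) / 2 * D / (lam * r) := by
    intro i
    have hbi : ‖b i‖ = 1 := b.orthonormal.1 i
    have hqi : IntegrableOn (fun x => ⟪fderiv ℝ U x (b i), fderiv ℝ Ψ x (b i)⟫) S volume :=
      integrableOn_zSlab_of_eq_zero_of_le_cylRadius (Q := fun x => ⟪fderiv ℝ U x (b i), fderiv ℝ Ψ x (b i)⟫)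
        ((hDUc.clm_apply continuous_const).inner ((hΨ1.continuous_fderiv one_ne_zero).clm_apply continuous_const))
        (fun x hx => by show ⟪fderiv ℝ U x (b i), fderiv ℝ Ψ x (b i)⟫ = 0; rw [hDΨ0 x hx]; simp) L 0
    refine hgen _ (by positivity) _ hqi (fun x => ‖fderiv ℝ U x (b i)‖) (fun x => norm_nonneg _)
      (fun x => hdi x i) fun x => ?_
    calc |⟪fderiv ℝ U x (b i), fderiv ℝ Ψ x (b i)⟫| ≤ ‖fderiv ℝ U x (b i)‖ * ‖fderiv ℝ Ψ x (b i)‖ :=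
          abs_real_inner_le_norm _ _
      _ ≤ ‖fderiv ℝ U x (b i)‖ * (L * C * (3 * M + Real.pi) / r * χ x) := by
          refine mul_le_mul_of_nonneg_left ?_ (norm_nonneg _)
          calc ‖fderiv ℝ Ψ x (b i)‖ ≤ ‖fderiv ℝ Ψ x‖ * ‖b i‖ := ContinuousLinearMap.le_opNorm _ _
            _ ≤ L * C * (3 * M + Real.pi) / r * χ x := by rw [hbi, mul_one]; exact hDΨn x
      _ = L * C * (3 * M + Real.pi) / r * χ x * ‖fderiv ℝ U x (b i)‖ := by ring
  have hGreenS : |∑ i, ∫ x in S, ⟪fderiv ℝ U x (b i), fderiv ℝ Ψ x (b i)⟫| ≤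
      3 * (16 * (L * C * (3 * M + Real.pi)) * L * lam * r) +
        3 * ((L * C * (3 * M + Real.pi)) / 2 * D / (lam * r)) := by
    refine (Finset.abs_sum_le_sum_abs _ _).trans ?_
    calc ∑ i, |∫ x in S, ⟪fderiv ℝ U x (b i), fderiv ℝ Ψ x (b i)⟫|
        ≤ ∑ _i : Fin 3, (16 * (L * C * (3 * M + Real.pi)) * L * lam * r +
            (L * C * (3 * M + Real.pi)) / 2 * D / (lam * r)) := Finset.sum_le_sum fun i _ => hGreen i
      _ = _ := by simp
  -- the convective corrector term
  have hConv : |∫ x in S, ⟪convect U U x, Ψ x⟫| ≤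
      16 * (M * (L * (Real.pi + M) * C)) * L * lam * r + (M * (L * (Real.pi + M) * C)) / 2 * D / (lam * r) := by
    have hqi : IntegrableOn (fun x => ⟪convect U U x, Ψ x⟫) S volume :=
      integrableOn_zSlab_of_eq_zero_of_le_cylRadius (Q := fun x => ⟪convect U U x, Ψ x⟫)
        ((hDUc.clm_apply hUc).inner hΨ1.continuous)
        (fun x hx => by show ⟪convect U U x, Ψ x⟫ = 0; rw [hΨ0 x hx, inner_zero_right]) L 0
    refine hgen _ (by positivity) _ hqi (fun x => ‖fderiv ℝ U x‖) (fun x => norm_nonneg _) hop fun x => ?_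
    rw [convect_apply]
    calc |⟪fderiv ℝ U x (U x), Ψ x⟫| ≤ ‖fderiv ℝ U x (U x)‖ * ‖Ψ x‖ := abs_real_inner_le_norm _ _
      _ ≤ (‖fderiv ℝ U x‖ * M) * (L * (Real.pi + M) * C / r * χ x) :=
          mul_le_mul ((ContinuousLinearMap.le_opNorm _ _).trans
            (mul_le_mul_of_nonneg_left (hM x) (norm_nonneg _))) (hΨn x) (norm_nonneg _) (by positivity)
      _ = M * (L * (Real.pi + M) * C) / r * χ x * ‖fderiv ℝ U x‖ := by ring
  -- assemble
  rw [hJ, hid]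
  have hsum := (abs_add_le _ _).trans (add_le_add hGreenS hConv)
  have e : 3 * (16 * (L * C * (3 * M + Real.pi)) * L * lam * r) +
        3 * ((L * C * (3 * M + Real.pi)) / 2 * D / (lam * r)) +
      (16 * (M * (L * (Real.pi + M) * C)) * L * lam * r + (M * (L * (Real.pi + M) * C)) / 2 * D / (lam * r)) =
      L * ((48 * C * L * (3 * M + Real.pi) + 16 * C * L * M * (Real.pi + M)) * lam * r +
        (3 / 2 * C * (3 * M + Real.pi) + 1 / 2 * C * M * (Real.pi + M)) * D / (lam * r)) := by
    ring
  exact hsum.trans_eq e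

end Literature.Analysis.SteadySlabLiouville.PeriodicSlab

end Part2

/-!
## Part 3 — port of `Summits/NavierStokesRegularity/NavierStokesRegularity/Theorems/ScenarioCensusPeriodicSlabDecayTerms.lean` (1 declarations kept)

# Census row S7 (c): the weighted dyadic energy inequality under radial decay

Support file for the scenario census of `NavierStokesRegularity` (cell `pub/ns-census`, block S,
row S7 = Bang–Gui–Wang–Xie, J. Fluid Mech. 1005 (2025) A6 = arXiv:2205.13259, Thm 1.4 (c)). The
printed §5 Step 3 bounds every cut-off term of the energy identity and arrives at
`Y(R) ≤ C₁ R‖u^r‖_{L^∞(𝒪_R)} + C₂ R^{1/2} Y'(R)^{1/2}`: the ONLY term that needs the decay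
`r u^r → 0` is the cubic one, (4-22); the pressure term is of Saint-Venant size through the
corrector. Here, on the dyadic annulus `{r ≤ ρ < 2r}` of one period `S = zSlab L 0` with
`φ = cylCutoff r (2r)`, for `r ≥ 1`, `λ > 0`, assuming `|⟪x_h, U x⟫| ≤ ε ≤ 1` for `ρ(x) ≥ r`:

* `decay_dyadic_weighted_estimate` —
  `∫_S φ|DU|² ≤ (16 C M² L + 64 C K₃ L²) ε + a λ r + c (∫_S χ|DU|²)/(λ r)` with explicit `a, c`
  depending only on `sup ‖U‖`, `L` and the cut-off constant `C` of `exists_corrField_bounds`;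
  the pressure term is split along `u^r = (u^r − ū^r) + ū^r` (foot-point splitting of rows
  S6/S7(a)(b) for the mean-free part, `corrector_pressure_bound` for the mean part).

No summit statement and no census row is proved in this file.

## References

* J. Bang, C. Gui, Y. Wang, C. Xie, arXiv:2205.13259, §5 Step 3, (4-21)–(4-37).
  [BangGuiWangXie2025]
-/

section Part3

open _root_.MeasureTheory _root_.Set _root_.Function _root_.Filter _root_.InnerProductSpace
open scoped _root_.Topology _root_.ENNReal _root_.NNReal RealInnerProductSpace Laplacian _root_.ContDiff

namespace Literature.Analysis.SteadySlabLiouville.PeriodicSlab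

open Literature.Analysis Literature.Analysis.FluidPDE
open Literature.Analysis.SteadySlabLiouville.HelicalSlab

/-- **The weighted dyadic energy inequality under radial decay** (Bang–Gui–Wang–Xie, §5 Step 3,
on the dyadic annulus `{r ≤ ρ < 2r}`). Let `(U, P)` be a smooth steady solution at unit
viscosity (`IsLerayProfile 1 0 U P`, `U, P ∈ C^∞`), both axially `L`-periodic (`L > 0`), with
`‖U‖ ≤ M`, `‖DU‖ ≤ K₁`, `‖DP‖ ≤ K₃`, `|DU|² ≤ B`; let `C` be the constant of
`exists_corrField_bounds` for the radius `r ≥ 1`. If `|⟪x_h, U x⟫| ≤ ε` for `ρ(x) ≥ r` with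
`0 < ε ≤ 1`, then for every `λ > 0`, with `φ = cylCutoff r (2r)`, `χ = 𝟙{r ≤ ρ < 2r}`,
`S = zSlab L 0`:
`∫_S φ|DU|² ≤ (16 C M² L + 64 C K₃ L²) ε`
`  + (96 C M L + 48 C L (3M + π) + 16 C L M (π + M)) λ r`
`  + (3 C M + (3/2) C (3M + π) + (1/2) C M (π + M)) (∫_S χ|DU|²)/(λ r)`.
[cite: BangGuiWangXie2025, Thm 1.4 (c), proof §5 (§2: the Bogovskiĭ-type corrector) (source of the ARGUMENT this module implements; this declaration is the cell’s own lemma or plumbing, NOT a printed statement)] -/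
theorem decay_dyadic_weighted_estimate {L M K₁ K₃ B C r lam ε : ℝ} (hL : 0 < L)
    {U : EuclideanSpace ℝ (Fin 3) → EuclideanSpace ℝ (Fin 3)} {P : EuclideanSpace ℝ (Fin 3) → ℝ}
    (h : IsLerayProfile 1 0 U P) (hU : ContDiff ℝ (⊤ : ℕ∞) U) (hP : ContDiff ℝ (⊤ : ℕ∞) P)
    (hUper : IsAxiallyPeriodic L U) (hPper : IsAxiallyPeriodic L P)
    (hM : ∀ x, ‖U x‖ ≤ M) (hK₁ : ∀ x, ‖fderiv ℝ U x‖ ≤ K₁) (hK₃ : ∀ x, ‖fderiv ℝ P x‖ ≤ K₃)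
    (hB : ∀ x, frobeniusNormSq (fderiv ℝ U x) ≤ B) (hC0 : 0 ≤ C)
    (ha : ∀ x, |dyCoeff r x| ≤
      C / r ^ 2 * {x | r ≤ cylRadius x ∧ cylRadius x < 2 * r}.indicator (fun _ => (1 : ℝ)) x)
    (hW : ∀ x, ‖corrField r x‖ ≤
      C / r * {x | r ≤ cylRadius x ∧ cylRadius x < 2 * r}.indicator (fun _ => (1 : ℝ)) x)
    (hDW : ∀ x, ‖fderiv ℝ (corrField r) x‖ ≤
      C / r ^ 2 * {x | r ≤ cylRadius x ∧ cylRadius x < 2 * r}.indicator (fun _ => (1 : ℝ)) x)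
    (hr : 1 ≤ r) (hlam : 0 < lam) (hε : 0 < ε) (hε1 : ε ≤ 1)
    (hdec : ∀ x, r ≤ cylRadius x → |⟪horizPart x, U x⟫| ≤ ε) :
    ∫ x in zSlab L 0, cylCutoff r (2 * r) x * frobeniusNormSq (fderiv ℝ U x) ≤
      (16 * C * M ^ 2 * L + 64 * C * K₃ * L ^ 2) * ε +
        (96 * C * M * L + 48 * C * L * (3 * M + Real.pi) + 16 * C * L * M * (Real.pi + M)) * lam * r +
        (3 * C * M + 3 / 2 * C * (3 * M + Real.pi) + 1 / 2 * C * M * (Real.pi + M)) *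
          (∫ x in zSlab L 0,
            {x | r ≤ cylRadius x ∧ cylRadius x < 2 * r}.indicator (fun _ => (1 : ℝ)) x *
              frobeniusNormSq (fderiv ℝ U x)) / (lam * r) := by
  set b := EuclideanSpace.basisFun (Fin 3) ℝ with hb
  set S : Set (EuclideanSpace ℝ (Fin 3)) := zSlab L 0 with hS
  set F : EuclideanSpace ℝ (Fin 3) → ℝ := fun x => frobeniusNormSq (fderiv ℝ U x) with hF
  set ur : EuclideanSpace ℝ (Fin 3) → ℝ := fun x => ⟪horizPart x, U x⟫ with hur
  have hr0 : 0 < r := by linarith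
  have hr2 : r < 2 * r := by linarith
  have hU1 : ContDiff ℝ 1 U := contDiff_infty.1 hU 1
  have hUc : Continuous U := hU1.continuous
  have hPc : Continuous P := hP.continuous
  have hPd : Differentiable ℝ P := (contDiff_infty.1 hP 1).differentiable one_ne_zero
  have hDUc : Continuous (fderiv ℝ U) := hU1.continuous_fderiv one_ne_zero
  have hFc : Continuous F := continuous_frobeniusNormSq_fderiv hU1 one_ne_zero
  have hurc : Continuous ur := horizPart.continuous.inner hUc
  have hF0 : ∀ x, 0 ≤ F x := fun x => frobeniusNormSq_nonneg _
  have hM0 : 0 ≤ M := (norm_nonneg _).trans (hM 0)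
  have hK₃0 : 0 ≤ K₃ := (norm_nonneg _).trans (hK₃ 0)
  have hdi : ∀ x i, ‖fderiv ℝ U x (b i)‖ ^ 2 ≤ F x := fun x i => norm_apply_sq_le_frobeniusNormSq b _ i
  -- the cut-off and the annulus
  set φ : EuclideanSpace ℝ (Fin 3) → ℝ := cylCutoff r (2 * r) with hφ
  have hφ2 : ContDiff ℝ 2 φ := contDiff_cylCutoff r (2 * r)
  have hφ1 : ContDiff ℝ 1 φ := contDiff_cylCutoff r (2 * r)
  have hDφc : Continuous (fderiv ℝ φ) := hφ1.continuous_fderiv one_ne_zero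
  have hφnn : ∀ x, 0 ≤ φ x := cylCutoff_nonneg r (2 * r)
  have hφzero : ∀ x, 2 * r ≤ cylRadius x → φ x = 0 := fun x hx => cylCutoff_eq_zero hr0.le hr2 hx
  have hφper : IsAxiallyPeriodic L φ := isAxiallyPeriodic_cylCutoff L r (2 * r)
  set a : EuclideanSpace ℝ (Fin 3) → ℝ := dyCoeff r with hadef
  have hDφa : ∀ x v, fderiv ℝ φ x v = a x * ⟪horizPart x, v⟫ := fun x v => fderiv_cylCutoff_two_mul r x v
  have hac : Continuous a := (contDiff_dyCoeff r (n := 0)).continuous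
  have haz : ∀ (x : EuclideanSpace ℝ (Fin 3)) (t : ℝ), a (x + t • eZ) = a x := dyCoeff_add_smul_eZ r
  set A : Set (EuclideanSpace ℝ (Fin 3)) := {x | r ≤ cylRadius x ∧ cylRadius x < 2 * r} with hA
  have hAm : MeasurableSet A :=
    (isClosed_le continuous_const continuous_cylRadius).measurableSet.inter
      (isOpen_lt continuous_cylRadius continuous_const).measurableSet
  set χ : EuclideanSpace ℝ (Fin 3) → ℝ := A.indicator fun _ => (1 : ℝ) with hχ
  have hχm : Measurable χ := measurable_const.indicator hAm
  have hχnn : ∀ x, 0 ≤ χ x := fun x => Set.indicator_nonneg (fun _ _ => zero_le_one) x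
  have hχle : ∀ x, χ x ≤ 1 := fun x => Set.indicator_le_self' (fun _ _ => zero_le_one) x
  have hχzero : ∀ x, 2 * r ≤ cylRadius x → χ x = 0 := fun x hx => by
    simp only [hχ, Set.indicator_apply, hA, mem_setOf_eq]
    rw [if_neg]; exact fun h' => absurd h'.2 (not_lt.2 hx)
  have ha0 : ∀ x, 2 * r ≤ cylRadius x → a x = 0 := fun x hx => by
    have h1 := ha x
    rw [hχzero x hx, mul_zero] at h1
    exact abs_eq_zero.1 (le_antisymm h1 (abs_nonneg _))
  -- `χ |u^r| ≤ χ ε` and `|∂ᵢφ| ≤ (2C/r) χ`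
  have hχur : ∀ x, χ x * |ur x| ≤ χ x * ε := by
    intro x
    by_cases hx : x ∈ A
    · exact mul_le_mul_of_nonneg_left (hdec x hx.1) (hχnn x)
    · have : χ x = 0 := by simp [hχ, hx]
      rw [this, zero_mul, zero_mul]
  have hDφi : ∀ x i, |fderiv ℝ φ x (b i)| ≤ 2 * C / r * χ x := by
    intro x i
    rw [hDφa x (b i), abs_mul]
    by_cases hx : x ∈ A
    · have hχ1 : χ x = 1 := by simp [hχ, hx]
      have h1 := ha x
      rw [hχ1, mul_one] at h1 ⊢
      have h2 : |⟪horizPart x, b i⟫| ≤ 2 * r := by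
        calc |⟪horizPart x, b i⟫| ≤ ‖horizPart x‖ * ‖b i‖ := abs_real_inner_le_norm _ _
          _ ≤ 2 * r := by rw [b.orthonormal.1 i, mul_one, norm_horizPart]; exact hx.2.le
      calc |a x| * |⟪horizPart x, b i⟫| ≤ C / r ^ 2 * (2 * r) := mul_le_mul h1 h2 (abs_nonneg _) (by positivity)
        _ = 2 * C / r := by field_simp
    · have hχ0 : χ x = 0 := by simp [hχ, hx]
      have h1 := ha x
      rw [hχ0, mul_zero] at h1 ⊢
      rw [abs_eq_zero.1 (le_antisymm h1 (abs_nonneg _)), abs_zero, zero_mul]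
  -- the identity per period
  have hid := steady_window_identity hL h hU hP hUper hPper hφ2 hφper hφnn hφzero
  -- the integrals
  set Iφ : ℝ := ∫ x in S, φ x * F x with hIφ
  set D : ℝ := ∫ x in S, χ x * F x with hD
  set V : ℝ := ∫ x in S, χ x with hVdef
  have hχ_int : IntegrableOn χ S volume :=
    integrableOn_zSlab_of_bound hL hχm.aestronglyMeasurable (ρ := 2 * r) hχzero (B := 1)
      fun x _ => by rw [Real.norm_eq_abs, abs_of_nonneg (hχnn x)]; exact hχle x
  have hB0 : 0 ≤ B := (hF0 0).trans (hB 0)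
  have hD_int : IntegrableOn (fun x => χ x * F x) S volume := by
    refine integrableOn_zSlab_of_bound hL ((hχm.mul hFc.measurable).aestronglyMeasurable)
      (ρ := 2 * r) (fun x hx => by rw [hχzero x hx, zero_mul]) (B := B) fun x _ => ?_
    rw [Real.norm_eq_abs, abs_mul, abs_of_nonneg (hχnn x), abs_of_nonneg (hF0 x)]
    exact (mul_le_mul (hχle x) (hB x) (hF0 x) zero_le_one).trans (by rw [one_mul])
  have hD0 : 0 ≤ D := setIntegral_nonneg (measurableSet_zSlab L 0) fun x _ => mul_nonneg (hχnn x) (hF0 x)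
  have hV : V ≤ 32 * L * r ^ 2 := by
    have h1 : V = volume.real (S ∩ A) := by
      rw [hVdef, hχ, setIntegral_indicator hAm, setIntegral_const, smul_eq_mul, mul_one]
    rw [h1, measureReal_def]
    refine ENNReal.toReal_le_of_le_ofReal (by positivity) ?_
    calc volume (S ∩ A) ≤ volume (zSlab L 0 ∩ {x | cylRadius x < 2 * r}) :=
          measure_mono fun x hx => ⟨hx.1, hx.2.2⟩
      _ ≤ ENNReal.ofReal (8 * L * (2 * r) ^ 2) := volume_zSlab_inter_cyl_le hL (by linarith)
      _ = ENNReal.ofReal (32 * L * r ^ 2) := by ring_nf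
  have hV0 : 0 ≤ V := setIntegral_nonneg (measurableSet_zSlab L 0) fun x _ => hχnn x
  -- the generic `ε`-bound: `|q| ≤ k χ ε` on `S` ⇒ `|∫_S q| ≤ k ε V ≤ 32 k L r² ε`
  have hsmall : ∀ k : ℝ, 0 ≤ k → ∀ q : EuclideanSpace ℝ (Fin 3) → ℝ, IntegrableOn q S volume →
      (∀ x ∈ S, |q x| ≤ k * (χ x * ε)) → |∫ x in S, q x| ≤ k * ε * (32 * L * r ^ 2) := by
    intro k hk q hqi hqb
    have h1 := norm_integral_le_of_norm_le (μ := volume.restrict S) ((hχ_int.const_mul (k * ε)))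
      ((ae_restrict_iff' (measurableSet_zSlab L 0)).2
        (Eventually.of_forall fun x hx => (?_ : ‖q x‖ ≤ k * ε * χ x)))
    · rw [Real.norm_eq_abs, integral_const_mul] at h1
      exact h1.trans (mul_le_mul_of_nonneg_left hV (by positivity))
    · rw [Real.norm_eq_abs]; exact (hqb x hx).trans (le_of_eq (by ring))
  -- T1: the Green terms (as for rows S6 / S7 (a)(b))
  have hT1 : ∀ i, |∫ x in S, fderiv ℝ φ x (b i) * ⟪fderiv ℝ U x (b i), U x⟫| ≤
      32 * C * M * L * lam * r + C * M * D / (lam * r) := by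
    intro i
    have hdom_int : IntegrableOn
        (fun x => C * M * lam / r * χ x + C * M / (r * lam) * (χ x * F x)) S volume :=
      (hχ_int.const_mul _).add (hD_int.const_mul _)
    have h1 := norm_integral_le_of_norm_le (μ := volume.restrict S) hdom_int
      (Eventually.of_forall fun x => (?_ :
        ‖fderiv ℝ φ x (b i) * ⟪fderiv ℝ U x (b i), U x⟫‖ ≤
          C * M * lam / r * χ x + C * M / (r * lam) * (χ x * F x)))
    · rw [Real.norm_eq_abs] at h1
      have h2 : ∫ x in S, (C * M * lam / r * χ x + C * M / (r * lam) * (χ x * F x)) =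
          C * M * lam / r * V + C * M / (r * lam) * D := by
        rw [integral_add (hχ_int.const_mul _) (hD_int.const_mul _), integral_const_mul,
          integral_const_mul]
      rw [h2] at h1
      have h3 : C * M * lam / r * V ≤ C * M * lam / r * (32 * L * r ^ 2) :=
        mul_le_mul_of_nonneg_left hV (by positivity)
      have e := alg_green C M L D r lam hr0.ne' hlam.ne'
      linarith
    · rw [norm_mul, Real.norm_eq_abs]
      have h2 := hDφi x i
      have h3 : ‖⟪fderiv ℝ U x (b i), U x⟫‖ ≤ ‖fderiv ℝ U x (b i)‖ * M :=
        (norm_inner_le_norm _ _).trans (mul_le_mul_of_nonneg_left (hM x) (norm_nonneg _))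
      have hy : ‖fderiv ℝ U x (b i)‖ ≤ (lam + ‖fderiv ℝ U x (b i)‖ ^ 2 / lam) / 2 := by
        have := young_abs_le ‖fderiv ℝ U x (b i)‖ hlam
        rwa [abs_of_nonneg (norm_nonneg _)] at this
      have hy' : ‖fderiv ℝ U x (b i)‖ ≤ (lam + F x / lam) / 2 :=
        hy.trans (by
          have := div_le_div_of_nonneg_right (hdi x i) hlam.le
          linarith)
      have h5 : 0 ≤ 2 * C / r * χ x := mul_nonneg (by positivity) (hχnn x)
      calc |fderiv ℝ φ x (b i)| * ‖⟪fderiv ℝ U x (b i), U x⟫‖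
          ≤ (2 * C / r * χ x) * (‖fderiv ℝ U x (b i)‖ * M) := mul_le_mul h2 h3 (norm_nonneg _) h5
        _ = (2 * C / r * χ x * M) * ‖fderiv ℝ U x (b i)‖ := by ring
        _ ≤ (2 * C / r * χ x * M) * ((lam + F x / lam) / 2) :=
            mul_le_mul_of_nonneg_left hy' (mul_nonneg h5 hM0)
        _ = C * M * lam / r * χ x + C * M / (r * lam) * (χ x * F x) := by
            field_simp
  have hT1s : |∑ i, ∫ x in S, fderiv ℝ φ x (b i) * ⟪fderiv ℝ U x (b i), U x⟫| ≤
      3 * (32 * C * M * L * lam * r) + 3 * (C * M * D / (lam * r)) := by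
    refine (Finset.abs_sum_le_sum_abs _ _).trans ?_
    calc ∑ i, |∫ x in S, fderiv ℝ φ x (b i) * ⟪fderiv ℝ U x (b i), U x⟫|
        ≤ ∑ _i : Fin 3, (32 * C * M * L * lam * r + C * M * D / (lam * r)) :=
          Finset.sum_le_sum fun i _ => hT1 i
      _ = 3 * (32 * C * M * L * lam * r) + 3 * (C * M * D / (lam * r)) := by simp
  -- T2: the cubic term — here the decay is used
  have hT2_int : IntegrableOn (fun x => fderiv ℝ φ x (U x) * ‖U x‖ ^ 2) S volume :=
    integrableOn_zSlab_of_eq_zero_of_le_cylRadius (Q := fun x => fderiv ℝ φ x (U x) * ‖U x‖ ^ 2)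
      ((hDφc.clm_apply hUc).mul (hUc.norm.pow 2))
      (fun x hx => by show fderiv ℝ φ x (U x) * ‖U x‖ ^ 2 = 0; rw [hDφa x (U x), ha0 x hx, zero_mul, zero_mul]) L 0
  have hT2 : |∫ x in S, fderiv ℝ φ x (U x) * ‖U x‖ ^ 2| ≤ C * M ^ 2 / r ^ 2 * ε * (32 * L * r ^ 2) := by
    refine hsmall (C * M ^ 2 / r ^ 2) (by positivity) _ hT2_int fun x _ => ?_
    rw [hDφa x (U x), abs_mul, abs_mul, abs_of_nonneg (sq_nonneg ‖U x‖)]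
    have h1 := ha x
    have h2 : ‖U x‖ ^ 2 ≤ M ^ 2 := pow_le_pow_left₀ (norm_nonneg _) (hM x) 2
    have h3 := hχur x
    calc |a x| * |ur x| * ‖U x‖ ^ 2 ≤ (C / r ^ 2 * χ x) * |ur x| * M ^ 2 :=
          mul_le_mul (mul_le_mul_of_nonneg_right h1 (abs_nonneg _)) h2 (sq_nonneg _)
            (mul_nonneg (mul_nonneg (by positivity) (hχnn x)) (abs_nonneg _))
      _ = C / r ^ 2 * M ^ 2 * (χ x * |ur x|) := by ring
      _ ≤ C / r ^ 2 * M ^ 2 * (χ x * ε) := mul_le_mul_of_nonneg_left h3 (by positivity)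
      _ = C * M ^ 2 / r ^ 2 * (χ x * ε) := by ring
  -- T3: the pressure term, `u^r = w + ū^r`
  set g : EuclideanSpace ℝ (Fin 3) → EuclideanSpace ℝ (Fin 3) := fun y => ∫ s in (0 : ℝ)..L, U (y + s • eZ)
    with hgdef
  obtain ⟨-, -, -, -, -, hgz, hrepr⟩ := verticalIntegral_props hL hU1 hM hK₁ h.divFree hUper
  have hgz' : ∀ (y : EuclideanSpace ℝ (Fin 3)) (t : ℝ), g (y + t • eZ) = g y := fun y t => hgz y t
  have hrepr' : ∀ y, ⟪horizPart y, g y⟫ = ∫ s in (0 : ℝ)..L, ⟪horizPart y, U (y + s • eZ)⟫ :=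
    fun y => hrepr y
  set w : EuclideanSpace ℝ (Fin 3) → ℝ := fun x => ur x - L⁻¹ * ⟪horizPart x, g x⟫ with hw
  have hgc : Continuous g := by
    have h := intervalIntegral.continuous_parametric_intervalIntegral_of_continuous'
      (μ := volume) (f := fun (y : EuclideanSpace ℝ (Fin 3)) (s : ℝ) => U (y + s • eZ))
      (by exact hUc.comp (continuous_fst.add (continuous_snd.smul continuous_const))) 0 L
    exact h
  have hwc : Continuous w := hurc.sub (continuous_const.mul (horizPart.continuous.inner hgc))
  have hwper : IsAxiallyPeriodic L w := fun x => by
    show ur (x + L • EuclideanSpace.single 2 (1 : ℝ)) - L⁻¹ * ⟪horizPart (x + L • EuclideanSpace.single 2 1),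
      g (x + L • EuclideanSpace.single 2 1)⟫ = ur x - L⁻¹ * ⟪horizPart x, g x⟫
    have e1 : ur (x + L • EuclideanSpace.single 2 (1 : ℝ)) = ur x := radial_periodic hUper x
    have e2 : horizPart (x + L • EuclideanSpace.single 2 (1 : ℝ)) = horizPart x := horizPart_add_smul_eZ x L
    have e3 : g (x + L • EuclideanSpace.single 2 (1 : ℝ)) = g x := hgz' x L
    rw [e1, e2, e3]
  have hwmean : ∀ x, ∫ s in (0 : ℝ)..L, w (x + s • eZ) = 0 := by
    intro x
    have e1 : (fun s : ℝ => w (x + s • eZ)) = fun s : ℝ => ur (x + s • eZ) - L⁻¹ * ⟪horizPart x, g x⟫ := by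
      funext s
      simp only [hw, horizPart_add_smul_eZ, hgz' x s]
    have hi : IntervalIntegrable (fun s : ℝ => ur (x + s • eZ)) volume 0 L :=
      (hurc.comp (continuous_const.add (continuous_id.smul continuous_const))).intervalIntegrable _ _
    rw [e1, intervalIntegral.integral_sub hi intervalIntegrable_const,
      intervalIntegral.integral_const, sub_zero, smul_eq_mul]
    have e2 : ∫ s in (0 : ℝ)..L, ur (x + s • eZ) = ⟪horizPart x, g x⟫ := by
      rw [hrepr' x]
      refine intervalIntegral.integral_congr fun s _ => ?_
      simp only [hur, horizPart_add_smul_eZ]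
    rw [e2]; field_simp; ring
  have hχw : ∀ x, χ x * |w x| ≤ χ x * (2 * ε) := by
    intro x
    by_cases hx : x ∈ A
    · refine mul_le_mul_of_nonneg_left ?_ (hχnn x)
      have h1 : |ur x| ≤ ε := hdec x hx.1
      have h2 : |⟪horizPart x, g x⟫| ≤ L * ε := by
        rw [hrepr' x]
        have h3 := intervalIntegral.norm_integral_le_of_norm_le_const (a := 0) (b := L)
          (f := fun s : ℝ => ⟪horizPart x, U (x + s • eZ)⟫) (C := ε) fun s _ => by
            rw [Real.norm_eq_abs, ← horizPart_add_smul_eZ x s]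
            refine hdec _ ?_
            have : cylRadius (x + s • eZ) = cylRadius x := by simp [cylRadius, eZ]
            rw [this]; exact hx.1
        rw [sub_zero, abs_of_pos hL, Real.norm_eq_abs] at h3
        linarith
      calc |w x| = |ur x - L⁻¹ * ⟪horizPart x, g x⟫| := rfl
        _ ≤ |ur x| + |L⁻¹ * ⟪horizPart x, g x⟫| := abs_sub _ _
        _ ≤ ε + L⁻¹ * (L * ε) := by
            rw [abs_mul, abs_of_pos (inv_pos.2 hL)]
            exact add_le_add h1 (mul_le_mul_of_nonneg_left h2 (inv_pos.2 hL).le)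
        _ = 2 * ε := by field_simp; ring
    · have : χ x = 0 := by simp [hχ, hx]
      rw [this, zero_mul, zero_mul]
  -- the splitting of the pressure integrand
  have hT3a_int : IntegrableOn (fun x => (P x - P (horizPart x)) * (a x * w x)) S volume :=
    integrableOn_zSlab_of_eq_zero_of_le_cylRadius (Q := fun x => (P x - P (horizPart x)) * (a x * w x))
      ((hPc.sub (hPc.comp horizPart.continuous)).mul (hac.mul hwc))
      (fun x hx => by show (P x - P (horizPart x)) * (a x * w x) = 0; rw [ha0 x hx, zero_mul, mul_zero]) L 0
  have hT3b_int : IntegrableOn (fun x => (P (horizPart x) * a x) * w x) S volume :=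
    integrableOn_zSlab_of_eq_zero_of_le_cylRadius (Q := fun x => (P (horizPart x) * a x) * w x)
      (((hPc.comp horizPart.continuous).mul hac).mul hwc)
      (fun x hx => by show (P (horizPart x) * a x) * w x = 0; rw [ha0 x hx, mul_zero, zero_mul]) L 0
  have hT3c_int : IntegrableOn (fun x => L⁻¹ * (P x * (a x * ⟪horizPart x, g x⟫))) S volume :=
    (integrableOn_zSlab_of_eq_zero_of_le_cylRadius (Q := fun x => P x * (a x * ⟪horizPart x, g x⟫))
      (hPc.mul (hac.mul (horizPart.continuous.inner hgc)))
      (fun x hx => by show P x * (a x * ⟪horizPart x, g x⟫) = 0; rw [ha0 x hx, zero_mul, mul_zero]) L 0).const_mul _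
  have hT3eq : ∫ x in S, P x * fderiv ℝ φ x (U x) =
      (∫ x in S, (P x - P (horizPart x)) * (a x * w x)) + (∫ x in S, (P (horizPart x) * a x) * w x) +
        ∫ x in S, L⁻¹ * (P x * (a x * ⟪horizPart x, g x⟫)) := by
    have i12 : IntegrableOn (fun x => (P x - P (horizPart x)) * (a x * w x) + (P (horizPart x) * a x) * w x)
        S volume := hT3a_int.add hT3b_int
    rw [← integral_add hT3a_int hT3b_int, ← integral_add i12 hT3c_int]
    refine setIntegral_congr_fun (measurableSet_zSlab L 0) fun x _ => ?_
    simp only [hw, hur, hDφa x (U x)]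
    field_simp
    ring
  have hT3b : ∫ x in S, (P (horizPart x) * a x) * w x = 0 := by
    obtain ⟨A₀, hA₀⟩ := (isCompact_closedBall (0 : EuclideanSpace ℝ (Fin 3)) (2 * r)).exists_bound_of_continuousOn
      hac.continuousOn
    obtain ⟨P₀, hP₀⟩ := (isCompact_closedBall (0 : EuclideanSpace ℝ (Fin 3)) (2 * r)).exists_bound_of_continuousOn
      hPc.continuousOn
    have hA₀0 : 0 ≤ A₀ := (norm_nonneg _).trans (hA₀ 0 (Metric.mem_closedBall_self (by linarith)))
    have hgm : Measurable fun x => P (horizPart x) * a x := ((hPc.comp horizPart.continuous).mul hac).measurable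
    have hgz' : ∀ (x : EuclideanSpace ℝ (Fin 3)) (s : ℝ),
        P (horizPart (x + s • eZ)) * a (x + s • eZ) = P (horizPart x) * a x := fun x s => by
      rw [horizPart_add_smul_eZ, haz]
    have hgG : ∀ x, |P (horizPart x) * a x| ≤ P₀ * A₀ := by
      intro x
      by_cases hx : 2 * r ≤ cylRadius x
      · rw [ha0 x hx, mul_zero, abs_zero]; exact mul_nonneg ((norm_nonneg _).trans (hP₀ 0
          (Metric.mem_closedBall_self (by linarith)))) hA₀0
      · rw [not_le] at hx
        have hmem : horizPart x ∈ Metric.closedBall (0 : EuclideanSpace ℝ (Fin 3)) (2 * r) := by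
          rw [mem_closedBall_zero_iff, norm_horizPart]; exact hx.le
        have hax : a x = a (horizPart x) := by
          conv_lhs => rw [← horizPart_add_apply_two_smul_eZ x]
          exact haz _ _
        rw [abs_mul, hax, ← Real.norm_eq_abs, ← Real.norm_eq_abs]
        exact mul_le_mul (hP₀ _ hmem) (hA₀ _ hmem) (norm_nonneg _)
          ((norm_nonneg _).trans (hP₀ _ hmem))
    have hgρ : ∀ x, 2 * r ≤ cylRadius x → P (horizPart x) * a x = 0 := fun x hx => by
      rw [ha0 x hx, mul_zero]
    exact setIntegral_zSlab_mul_eq_zero_of_verticalMean hL hgm hgz' hgG hgρ hwc hwper hwmean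
  have hT3a : |∫ x in S, (P x - P (horizPart x)) * (a x * w x)| ≤ K₃ * L * C / r ^ 2 * 2 * ε * (32 * L * r ^ 2) := by
    refine hsmall (K₃ * L * C / r ^ 2 * 2) (by positivity) _ hT3a_int fun x hx => ?_
    rw [abs_mul, abs_mul]
    have h1 : |P x - P (horizPart x)| ≤ K₃ * L := abs_sub_footPressure_le hPd hK₃ hx
    have h2 := ha x
    have h3 := hχw x
    calc |P x - P (horizPart x)| * (|a x| * |w x|) ≤ (K₃ * L) * (C / r ^ 2 * χ x * |w x|) := by
          refine mul_le_mul h1 (mul_le_mul_of_nonneg_right h2 (abs_nonneg _)) (by positivity) (by positivity)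
      _ = K₃ * L * C / r ^ 2 * (χ x * |w x|) := by ring
      _ ≤ K₃ * L * C / r ^ 2 * (χ x * (2 * ε)) := mul_le_mul_of_nonneg_left h3 (by positivity)
      _ = K₃ * L * C / r ^ 2 * 2 * (χ x * ε) := by ring
  have hT3c : |∫ x in S, L⁻¹ * (P x * (a x * ⟪horizPart x, g x⟫))| ≤
      (48 * C * L * (3 * M + Real.pi) + 16 * C * L * M * (Real.pi + M)) * lam * r +
        (3 / 2 * C * (3 * M + Real.pi) + 1 / 2 * C * M * (Real.pi + M)) * D / (lam * r) := by
    have hcore := corrector_pressure_bound hL h hU hP hUper hPper hM hK₁ hB hC0 hW hDW hr hlam hε1 hdec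
    rw [integral_const_mul, abs_mul, abs_of_pos (inv_pos.2 hL)]
    rw [inv_mul_le_iff₀ hL]
    exact hcore
  -- assemble
  have hmain : Iφ = -(∑ i, ∫ x in S, fderiv ℝ φ x (b i) * ⟪fderiv ℝ U x (b i), U x⟫) +
      2⁻¹ * (∫ x in S, fderiv ℝ φ x (U x) * ‖U x‖ ^ 2) +
      ∫ x in S, P x * fderiv ℝ φ x (U x) := hid
  rw [hT3eq, hT3b, add_zero] at hmain
  have a1 := (abs_le.1 hT1s).1
  have a2 := (abs_le.1 hT2).2
  have a3 := (abs_le.1 hT3a).2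
  have a4 := (abs_le.1 hT3c).2
  have e2 : C * M ^ 2 / r ^ 2 * ε * (32 * L * r ^ 2) = 32 * C * M ^ 2 * L * ε := by field_simp
  have e3 : K₃ * L * C / r ^ 2 * 2 * ε * (32 * L * r ^ 2) = 64 * C * K₃ * L ^ 2 * ε := by
    field_simp; ring
  rw [e2] at a2
  rw [e3] at a3
  have hfin : Iφ ≤ 3 * (32 * C * M * L * lam * r) + 3 * (C * M * D / (lam * r)) +
      2⁻¹ * (32 * C * M ^ 2 * L * ε) + 64 * C * K₃ * L ^ 2 * ε +
      ((48 * C * L * (3 * M + Real.pi) + 16 * C * L * M * (Real.pi + M)) * lam * r +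
        (3 / 2 * C * (3 * M + Real.pi) + 1 / 2 * C * M * (Real.pi + M)) * D / (lam * r)) := by
    rw [hmain]; linarith
  have e : 3 * (32 * C * M * L * lam * r) + 3 * (C * M * D / (lam * r)) +
      2⁻¹ * (32 * C * M ^ 2 * L * ε) + 64 * C * K₃ * L ^ 2 * ε +
      ((48 * C * L * (3 * M + Real.pi) + 16 * C * L * M * (Real.pi + M)) * lam * r +
        (3 / 2 * C * (3 * M + Real.pi) + 1 / 2 * C * M * (Real.pi + M)) * D / (lam * r)) =
      (16 * C * M ^ 2 * L + 64 * C * K₃ * L ^ 2) * ε +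
        (96 * C * M * L + 48 * C * L * (3 * M + Real.pi) + 16 * C * L * M * (Real.pi + M)) * lam * r +
        (3 * C * M + 3 / 2 * C * (3 * M + Real.pi) + 1 / 2 * C * M * (Real.pi + M)) * D / (lam * r) := by
    ring
  rw [← e]
  exact hfin

end Literature.Analysis.SteadySlabLiouville.PeriodicSlab

end Part3

/-!
## Part 4 — port of `Summits/NavierStokesRegularity/NavierStokesRegularity/Theorems/ScenarioCensusPeriodicSlabDecayLiouville.lean` (4 declarations kept)

# Census row S7 (c): bounded periodic steady flows with `r u^r → 0` are axial constants
# (Bang–Gui–Wang–Xie 2025, Thm 1.4 (c))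

Support file for the scenario census of `NavierStokesRegularity` (cell `pub/ns-census`, block S,
row S7 = Bang–Gui–Wang–Xie, J. Fluid Mech. 1005 (2025) A6 = arXiv:2205.13259, Thm 1.4; tree FACT
`Literature.Analysis.FluidPDE.BangGuiWangXie2025_periodicSlab_liouville`). Case (c): "Let `u` be
a bounded smooth solution to the Navier–Stokes system in `ℝ² × 𝕋`. Then `u` must be a constant
vector provided that … (c) `r u^r` converges to `0`, as `r → +∞` … the constant vector `u` must
be of the form `(0, 0, c)`." Printed proof, §5 Step 3: the Saint-Venant estimate
`Y(R) ≤ C₁ R‖u^r‖_{L^∞(𝒪_R)} + C₂ R^{1/2} Y'(R)^{1/2}`, then "since `r u^r` converges to zero,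
there exists some `R₁ > R₀` such that `Y(R₀) ≥ 2C₁ R‖u^r‖_{L^∞(𝒪_R)}` for every `R ≥ R₁`. Hence
`Y(R) ≤ 2C₂ R^{1/2} Y'(R)^{1/2}`, which leads to contradiction."

* `saintVenant_dyadic_eventually` — the dyadic Saint-Venant lemma with an additive `o(1)` term
  (reduction to `saintVenant_dyadic` by the printed absorption argument and a rescaling);
* `decay_energy_dyadic_estimate` — the energy form of `decay_dyadic_weighted_estimate`;
* `periodicSlab_liouville_radialDecay` — **Thm 1.4 (c)** for every `ν > 0`, `L > 0`: a smooth
  steady solution (`IsLerayProfile ν 0 U P`, `U, P ∈ C^∞`), bounded, axially `L`-periodic, with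
  `r u^r → 0` uniformly, is `U ≡ c e₃`.

No summit statement and no census row is proved in this file (the by-name closer of row S7 is
the leaf file `ScenarioCensusSteadyS7.lean`).

## References

* J. Bang, C. Gui, Y. Wang, C. Xie, arXiv:2205.13259, Thm 1.4 (c), §5 Step 3.
  [BangGuiWangXie2025]
-/

section Part4

open _root_.MeasureTheory _root_.Set _root_.Function _root_.Filter _root_.InnerProductSpace
open scoped _root_.Topology _root_.ENNReal _root_.NNReal RealInnerProductSpace Laplacian _root_.ContDiff

namespace Literature.Analysis.SteadySlabLiouville.PeriodicSlab

open Literature.Analysis Literature.Analysis.FluidPDE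
open Literature.Analysis.SteadySlabLiouville.HelicalSlab

/-! ### The dyadic Saint-Venant lemma with an `o(1)` term -/

/-- **The dyadic Saint-Venant lemma with a vanishing additive term.** Let `E` be nondecreasing
and nonnegative on `[1, ∞)` with `E(r) ≤ A r²`, and suppose that for every `ε > 0` there is
`R ≥ 1` with `E(r) ≤ ε + γ (E(2r) − E(r))/r + a λ r + b (E(2r) − E(r))/(λ r)` for all `r ≥ R`,
`λ > 0` (`γ, a, b ≥ 0`). Then `E ≡ 0` on `[1, ∞)`. (If `E(r₀) > 0`, take `ε = E(r₀)/2`, absorb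
it for `r ≥ max R r₀`, rescale `r = R₁ s` and apply `saintVenant_dyadic` with `ν = 1/2`.)
[cite: BangGuiWangXie2025, Thm 1.4 (c), proof §5 (§2: the Bogovskiĭ-type corrector) (source of the ARGUMENT this module implements; this declaration is the cell’s own lemma or plumbing, NOT a printed statement)] -/
theorem saintVenant_dyadic_eventually {E : ℝ → ℝ} {γ a b A : ℝ} (hγ : 0 ≤ γ) (ha : 0 ≤ a)
    (hb : 0 ≤ b) (hmono : ∀ r s, 1 ≤ r → r ≤ s → E r ≤ E s) (h0 : ∀ r, 1 ≤ r → 0 ≤ E r)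
    (hA : ∀ r, 1 ≤ r → E r ≤ A * r ^ 2)
    (h : ∀ ε : ℝ, 0 < ε → ∃ R : ℝ, 1 ≤ R ∧ ∀ r, R ≤ r → ∀ lam : ℝ, 0 < lam →
      E r ≤ ε + γ * (E (2 * r) - E r) / r + a * lam * r + b * (E (2 * r) - E r) / (lam * r)) :
    ∀ r, 1 ≤ r → E r = 0 := by
  intro r₀ hr₀
  by_contra hne
  have he₀ : 0 < E r₀ := lt_of_le_of_ne (h0 r₀ hr₀) (Ne.symm hne)
  obtain ⟨R, hR1, hR⟩ := h (E r₀ / 2) (by linarith)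
  set R₁ : ℝ := max R r₀ with hR₁
  have hR₁R : R ≤ R₁ := le_max_left _ _
  have hR₁r₀ : r₀ ≤ R₁ := le_max_right _ _
  have hR₁1 : 1 ≤ R₁ := le_trans hr₀ hR₁r₀
  have hR₁0 : 0 < R₁ := by linarith
  -- the rescaled energy
  set E' : ℝ → ℝ := fun s => E (R₁ * s) with hE'
  have hmono' : ∀ s t, 1 ≤ s → s ≤ t → E' s ≤ E' t := fun s t hs hst =>
    hmono _ _ (by nlinarith) (mul_le_mul_of_nonneg_left hst hR₁0.le)
  have h0' : ∀ s, 1 ≤ s → 0 ≤ E' s := fun s hs => h0 _ (by nlinarith)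
  have hA' : ∀ s, 1 ≤ s → E' s ≤ A * R₁ ^ 2 * s ^ 2 := fun s hs => by
    have := hA (R₁ * s) (by nlinarith)
    simp only [hE']
    nlinarith
  have hineq : ∀ s, 1 ≤ s → ∀ lam : ℝ, 0 < lam →
      (1 / 2) * E' s ≤ γ / R₁ * (E' (2 * s) - E' s) / s + (a * R₁) * lam * s +
        b / R₁ * (E' (2 * s) - E' s) / (lam * s) := by
    intro s hs lam hlam
    have hs0 : 0 < s := by linarith
    have hrR : R ≤ R₁ * s := le_trans hR₁R (by nlinarith)
    have h1 := hR (R₁ * s) hrR lam hlam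
    have h2 : E r₀ ≤ E (R₁ * s) := hmono _ _ hr₀ (le_trans hR₁r₀ (by nlinarith))
    have e1 : E (2 * (R₁ * s)) = E' (2 * s) := by simp only [hE']; ring_nf
    have e2 : E (R₁ * s) = E' s := rfl
    rw [e1, e2] at h1
    rw [e2] at h2
    have e3 : γ * (E' (2 * s) - E' s) / (R₁ * s) = γ / R₁ * (E' (2 * s) - E' s) / s := by
      field_simp
    have e4 : b * (E' (2 * s) - E' s) / (lam * (R₁ * s)) = b / R₁ * (E' (2 * s) - E' s) / (lam * s) := by
      field_simp
    have e5 : a * lam * (R₁ * s) = (a * R₁) * lam * s := by ring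
    rw [e3, e4, e5] at h1
    linarith
  have hzero := saintVenant_dyadic (ν := 1 / 2) (by norm_num) (div_nonneg hγ hR₁0.le)
    (mul_nonneg ha hR₁0.le) (div_nonneg hb hR₁0.le) hmono' h0' hA' hineq 1 le_rfl
  have h3 : E r₀ ≤ E' 1 := by simp only [hE', mul_one]; exact hmono _ _ hr₀ hR₁r₀
  linarith

/-! ### The dyadic estimate in energy form -/

/-- **The dyadic energy estimate under radial decay.** For a smooth steady flow at unit
viscosity, axially periodic with periodic pressure, bounded with bounded gradient and pressure
gradient (`‖U‖ ≤ M`, `‖DU‖ ≤ K₁`, `|DU|² ≤ B`, `‖DP‖ ≤ K₃`), whose radial velocity satisfies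
`sup_{ρ ≥ R} |⟪x_h, U⟫| → 0` as `R → ∞`: with `E(r) = ∫_{zSlab L 0 ∩ {ρ<r}} |DU|²` there are
`a, c, K ≥ 0` such that for every `0 < ε ≤ 1` there is `R ≥ 1` with
`E(r) ≤ K ε + a λ r + c (E(2r) − E(r))/(λ r)` for all `r ≥ R`, `λ > 0`.
[cite: BangGuiWangXie2025, Thm 1.4 (c), proof §5 (§2: the Bogovskiĭ-type corrector) (source of the ARGUMENT this module implements; this declaration is the cell’s own lemma or plumbing, NOT a printed statement)] -/
theorem decay_energy_dyadic_estimate {L M K₁ K₃ B : ℝ} (hL : 0 < L)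
    {U : EuclideanSpace ℝ (Fin 3) → EuclideanSpace ℝ (Fin 3)} {P : EuclideanSpace ℝ (Fin 3) → ℝ}
    (h : IsLerayProfile 1 0 U P) (hU : ContDiff ℝ (⊤ : ℕ∞) U) (hP : ContDiff ℝ (⊤ : ℕ∞) P)
    (hUper : IsAxiallyPeriodic L U) (hPper : IsAxiallyPeriodic L P)
    (hM : ∀ x, ‖U x‖ ≤ M) (hK₁ : ∀ x, ‖fderiv ℝ U x‖ ≤ K₁)
    (hB : ∀ x, frobeniusNormSq (fderiv ℝ U x) ≤ B) (hK₃ : ∀ x, ‖fderiv ℝ P x‖ ≤ K₃)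
    (hdecay : ∀ ε : ℝ, 0 < ε → ∃ R : ℝ, ∀ x, R ≤ cylRadius x → |⟪horizPart x, U x⟫| ≤ ε)
    (E : ℝ → ℝ) (hE : ∀ r, E r = ∫ x in zSlab L 0 ∩ {x | cylRadius x < r},
      frobeniusNormSq (fderiv ℝ U x)) :
    ∃ a c K : ℝ, 0 ≤ a ∧ 0 ≤ c ∧ 0 ≤ K ∧ ∀ ε : ℝ, 0 < ε → ε ≤ 1 → ∃ R : ℝ, 1 ≤ R ∧
      ∀ r : ℝ, R ≤ r → ∀ lam : ℝ, 0 < lam →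
        E r ≤ K * ε + a * lam * r + c * (E (2 * r) - E r) / (lam * r) := by
  obtain ⟨C, hC0, hC⟩ := exists_corrField_bounds
  have hM0 : 0 ≤ M := (norm_nonneg _).trans (hM 0)
  have hK₃0 : 0 ≤ K₃ := (norm_nonneg _).trans (hK₃ 0)
  have hU1 : ContDiff ℝ 1 U := contDiff_infty.1 hU 1
  set F : EuclideanSpace ℝ (Fin 3) → ℝ := fun x => frobeniusNormSq (fderiv ℝ U x) with hF
  have hFc : Continuous F := continuous_frobeniusNormSq_fderiv hU1 one_ne_zero
  have hF0 : ∀ x, 0 ≤ F x := fun x => frobeniusNormSq_nonneg _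
  refine ⟨96 * C * M * L + 48 * C * L * (3 * M + Real.pi) + 16 * C * L * M * (Real.pi + M),
    3 * C * M + 3 / 2 * C * (3 * M + Real.pi) + 1 / 2 * C * M * (Real.pi + M),
    16 * C * M ^ 2 * L + 64 * C * K₃ * L ^ 2, by positivity, by positivity, by positivity, ?_⟩
  intro ε hε hε1
  obtain ⟨R₀, hR₀⟩ := hdecay ε hε
  refine ⟨max 1 R₀, le_max_left _ _, fun r hr lam hlam => ?_⟩
  have hr1 : 1 ≤ r := le_trans (le_max_left _ _) hr
  have hr0 : 0 < r := by linarith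
  have hr2 : r < 2 * r := by linarith
  have hdec : ∀ x, r ≤ cylRadius x → |⟪horizPart x, U x⟫| ≤ ε := fun x hx =>
    hR₀ x (le_trans (le_trans (le_max_right _ _) hr) hx)
  obtain ⟨ha, hW, hDW⟩ := hC r hr0
  have hA := decay_dyadic_weighted_estimate hL h hU hP hUper hPper hM hK₁ hK₃ hB hC0 ha hW hDW hr1 hlam
    hε hε1 hdec
  -- abbreviations
  set S : Set (EuclideanSpace ℝ (Fin 3)) := zSlab L 0 with hS
  set φ : EuclideanSpace ℝ (Fin 3) → ℝ := cylCutoff r (2 * r) with hφ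
  set A : Set (EuclideanSpace ℝ (Fin 3)) := {x | r ≤ cylRadius x ∧ cylRadius x < 2 * r} with hAdef
  set χ : EuclideanSpace ℝ (Fin 3) → ℝ := A.indicator fun _ => (1 : ℝ) with hχ
  set Iφ : ℝ := ∫ x in S, φ x * F x with hIφ
  set D : ℝ := ∫ x in S, χ x * F x with hD
  have hφc : Continuous φ := (contDiff_cylCutoff r (2 * r) (n := 0)).continuous
  have hφnn : ∀ x, 0 ≤ φ x := cylCutoff_nonneg r (2 * r)
  have hφone : ∀ x, cylRadius x ≤ r → φ x = 1 := fun x hx => cylCutoff_eq_one hr0.le hr2 hx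
  have hφzero : ∀ x, 2 * r ≤ cylRadius x → φ x = 0 := fun x hx => cylCutoff_eq_zero hr0.le hr2 hx
  have hAm : MeasurableSet A :=
    (isClosed_le continuous_const continuous_cylRadius).measurableSet.inter
      (isOpen_lt continuous_cylRadius continuous_const).measurableSet
  have hIφ_int : IntegrableOn (fun x => φ x * F x) S volume :=
    integrableOn_zSlab_of_eq_zero_of_le_cylRadius (Q := fun x => φ x * F x) (hφc.mul hFc)
      (fun x hx => by show φ x * F x = 0; rw [hφzero x hx, zero_mul]) L 0
  have hF_int2 : IntegrableOn F (S ∩ {x | cylRadius x < 2 * r}) volume :=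
    integrableOn_zSlab_inter_cyl_of_bound hL (by linarith) hFc (B := B) fun x => by
      rw [Real.norm_of_nonneg (hF0 x)]; exact hB x
  have hmeas : MeasurableSet (S ∩ {x : EuclideanSpace ℝ (Fin 3) | cylRadius x < r}) :=
    (measurableSet_zSlab L 0).inter (isOpen_lt continuous_cylRadius continuous_const).measurableSet
  have hsub : S ∩ {x | cylRadius x < r} ⊆ S ∩ {x | cylRadius x < 2 * r} :=
    fun x hx => ⟨hx.1, lt_trans hx.2 hr2⟩
  -- `E(r) ≤ Iφ`
  have hEr : E r ≤ Iφ := by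
    rw [hE r]
    calc ∫ x in S ∩ {x | cylRadius x < r}, F x
        = ∫ x in S, (S ∩ {x | cylRadius x < r}).indicator F x := by
          rw [setIntegral_indicator hmeas, Set.inter_eq_self_of_subset_right inter_subset_left]
      _ ≤ Iφ := by
          refine setIntegral_mono_on ((hF_int2.mono_set hsub).integrable_indicator hmeas |>.integrableOn)
            hIφ_int (measurableSet_zSlab L 0) fun x _ => ?_
          by_cases hx : x ∈ S ∩ {x | cylRadius x < r}
          · rw [Set.indicator_of_mem hx, hφone x (le_of_lt hx.2), one_mul]
          · rw [Set.indicator_of_notMem hx]; exact mul_nonneg (hφnn x) (hF0 x)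
  -- `E(2r) − E(r) = D`
  have hED : E (2 * r) - E r = D := by
    rw [hE (2 * r), hE r, hD]
    have hdiff : (S ∩ {x | cylRadius x < 2 * r}) \ (S ∩ {x | cylRadius x < r}) = S ∩ A := by
      ext x
      constructor
      · rintro ⟨⟨hxS, hx2⟩, hnot⟩
        refine ⟨hxS, ?_, hx2⟩
        by_contra hlt
        exact hnot ⟨hxS, not_le.1 hlt⟩
      · rintro ⟨hxS, h1, h2⟩
        exact ⟨⟨hxS, h2⟩, fun h' => (not_lt.2 h1) h'.2⟩
    rw [← setIntegral_sdiff hmeas hF_int2 hsub, hdiff, ← setIntegral_indicator hAm]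
    refine setIntegral_congr_fun (measurableSet_zSlab L 0) fun x _ => ?_
    by_cases hx : x ∈ A
    · simp [hχ, hx]
    · simp [hχ, hx]
  rw [hED]
  exact hEr.trans hA

/-! ### The Liouville theorem -/

/-- **Bang–Gui–Wang–Xie 2025, Thm 1.4 (c), at unit viscosity.** A smooth steady Navier–Stokes
flow on `ℝ³` with `ν = 1` (`IsLerayProfile 1 0 U P`, `U, P ∈ C^∞`), bounded, axially `L`-periodic
(`L > 0`), with `r u^r → 0` uniformly as `r → ∞`, is an axial constant `U ≡ c e₃`.
[cite: BangGuiWangXie2025, Thm 1.4 (c), proof §5 (§2: the Bogovskiĭ-type corrector) (source of the ARGUMENT this module implements; this declaration is the cell’s own lemma or plumbing, NOT a printed statement)] -/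
theorem periodicSlab_liouville_radialDecay_one {L : ℝ} (hL : 0 < L)
    {U : EuclideanSpace ℝ (Fin 3) → EuclideanSpace ℝ (Fin 3)} {P : EuclideanSpace ℝ (Fin 3) → ℝ}
    (hprof : IsLerayProfile 1 0 U P) (hU : ContDiff ℝ (⊤ : ℕ∞) U) (hP : ContDiff ℝ (⊤ : ℕ∞) P)
    (hbd : ∃ M : ℝ, ∀ x, ‖U x‖ ≤ M) (hper : IsAxiallyPeriodic L U)
    (hdecay : ∀ ε : ℝ, 0 < ε → ∃ R : ℝ, ∀ x, R ≤ cylRadius x →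
      |cylRadius x * radialVelocity U x| ≤ ε) :
    ∃ c : ℝ, U = fun _ => c • eZ := by
  obtain ⟨M, hM⟩ := hbd
  have hst : IsSteadyClassicalNS 1 0 U P := isSteadyClassicalNS_of_isLerayProfile hprof hU hP
  have hPper : IsAxiallyPeriodic L P := steady_pressure_periodic hL hst hM hper
  obtain ⟨K₁, K₂, K₃, -, -, -, hK⟩ := steady_derivative_bounds one_pos hst hM
  have hK₁ : ∀ x, ‖fderiv ℝ U x‖ ≤ K₁ := fun x => (hK x).1
  have hK₃ : ∀ x, ‖fderiv ℝ P x‖ ≤ K₃ := fun x => by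
    have e : ‖fderiv ℝ P x‖ = ‖gradient P x‖ := by
      rw [gradient]; exact ((InnerProductSpace.toDual ℝ (EuclideanSpace ℝ (Fin 3))).symm.norm_map _).symm
    rw [e]; exact (hK x).2.2
  have hU1 : ContDiff ℝ 1 U := contDiff_infty.1 hU 1
  have hUd : Differentiable ℝ U := hU1.differentiable one_ne_zero
  have hdecay' : ∀ ε : ℝ, 0 < ε → ∃ R : ℝ, ∀ x, R ≤ cylRadius x → |⟪horizPart x, U x⟫| ≤ ε := by
    intro ε hε
    obtain ⟨R, hR⟩ := hdecay ε hε
    refine ⟨R, fun x hx => ?_⟩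
    have e : ⟪horizPart x, U x⟫ = cylRadius x * radialVelocity U x := by
      rw [radialVelocity, horizPart_eq_cylRadius_smul_eR, real_inner_smul_left, real_inner_comm]
    rw [e]; exact hR x hx
  -- the period energies
  set F : EuclideanSpace ℝ (Fin 3) → ℝ := fun x => frobeniusNormSq (fderiv ℝ U x) with hF
  set E : ℝ → ℝ := fun r => ∫ x in zSlab L 0 ∩ {x | cylRadius x < r}, F x with hE
  have hFc : Continuous F := continuous_frobeniusNormSq_fderiv hU1 one_ne_zero
  have hF0 : ∀ x, 0 ≤ F x := fun x => frobeniusNormSq_nonneg _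
  set b := EuclideanSpace.basisFun (Fin 3) ℝ with hb
  have hFB' : ∀ x, F x ≤ 3 * K₁ ^ 2 := fun x => by
    show frobeniusNormSq (fderiv ℝ U x) ≤ 3 * K₁ ^ 2
    rw [frobeniusNormSq_eq_sum b]
    calc ∑ i, ‖fderiv ℝ U x (b i)‖ ^ 2 ≤ ∑ _i : Fin 3, K₁ ^ 2 := Finset.sum_le_sum fun i _ => by
          have h1 : ‖fderiv ℝ U x (b i)‖ ≤ K₁ := by
            calc ‖fderiv ℝ U x (b i)‖ ≤ ‖fderiv ℝ U x‖ * ‖b i‖ := ContinuousLinearMap.le_opNorm _ _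
              _ ≤ K₁ := by rw [b.orthonormal.1 i, mul_one]; exact hK₁ x
          exact pow_le_pow_left₀ (norm_nonneg _) h1 2
      _ = 3 * K₁ ^ 2 := by simp
  have hFB : ∀ x, ‖F x‖ ≤ 3 * K₁ ^ 2 := fun x => by
    rw [Real.norm_of_nonneg (hF0 x)]; exact hFB' x
  obtain ⟨a, c, K, ha, hc, hK0, hineq⟩ := decay_energy_dyadic_estimate hL hprof hU hP hper hPper hM
    hK₁ hFB' hK₃ hdecay' E (fun r => rfl)
  have hFper : IsAxiallyPeriodic L F := fun x => by
    simp only [hF, isAxiallyPeriodic_fderiv hper x]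
  have hEint : ∀ r, 0 < r → IntegrableOn F (zSlab L 0 ∩ {x | cylRadius x < r}) volume :=
    fun r hr => integrableOn_zSlab_inter_cyl_of_bound hL hr hFc hFB
  have hmono : ∀ r s, 1 ≤ r → r ≤ s → E r ≤ E s := fun r s hr hrs =>
    setIntegral_mono_set (hEint s (by linarith)) (Eventually.of_forall fun x => hF0 x)
      (Eventually.of_forall fun x hx => ⟨hx.1, lt_of_lt_of_le hx.2 hrs⟩)
  have hE0 : ∀ r, 1 ≤ r → 0 ≤ E r := fun r _ =>
    setIntegral_nonneg ((measurableSet_zSlab L 0).inter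
      (isOpen_lt continuous_cylRadius continuous_const).measurableSet) fun x _ => hF0 x
  have hEA : ∀ r, 1 ≤ r → E r ≤ 3 * K₁ ^ 2 * (8 * L) * r ^ 2 := by
    intro r hr
    have hr0 : 0 < r := by linarith
    have hvol := volume_zSlab_inter_cyl_le hL hr0
    have hfin : volume (zSlab L 0 ∩ {x | cylRadius x < r}) ≠ ⊤ :=
      (lt_of_le_of_lt hvol ENNReal.ofReal_lt_top).ne
    have hmeas : MeasurableSet (zSlab L 0 ∩ {x : EuclideanSpace ℝ (Fin 3) | cylRadius x < r}) :=
      (measurableSet_zSlab L 0).inter (isOpen_lt continuous_cylRadius continuous_const).measurableSet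
    calc E r ≤ ∫ x in zSlab L 0 ∩ {x | cylRadius x < r}, (3 * K₁ ^ 2 : ℝ) := by
          refine setIntegral_mono_on (hEint r hr0) ?_ hmeas fun x _ => ?_
          · exact integrableOn_const hfin
          · exact hFB' x
      _ = (volume (zSlab L 0 ∩ {x | cylRadius x < r})).toReal * (3 * K₁ ^ 2) := by
          rw [setIntegral_const, smul_eq_mul, measureReal_def]
      _ ≤ (8 * L * r ^ 2) * (3 * K₁ ^ 2) :=
          mul_le_mul_of_nonneg_right (ENNReal.toReal_le_of_le_ofReal (by positivity) hvol)
            (by positivity)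
      _ = 3 * K₁ ^ 2 * (8 * L) * r ^ 2 := by ring
  -- the `o(1)` Saint-Venant lemma
  have hEzero : ∀ r, 1 ≤ r → E r = 0 := by
    refine saintVenant_dyadic_eventually (γ := 0) le_rfl ha hc hmono hE0 hEA fun ε hε => ?_
    obtain ⟨R, hR1, hR⟩ := hineq (min ε 1 / (K + 1)) (by positivity)
      ((div_le_one (by positivity)).2 ((min_le_right _ _).trans (by linarith)))
    refine ⟨R, hR1, fun r hr lam hlam => ?_⟩
    have h1 := hR r hr lam hlam
    have h2 : K * (min ε 1 / (K + 1)) ≤ ε := by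
      rw [mul_div_assoc']
      rw [div_le_iff₀ (by positivity)]
      nlinarith [min_le_left ε 1, min_le_right ε 1, hK0, hε]
    have hr0 : 0 < r := by linarith
    rw [zero_mul, zero_div]
    linarith
  -- `DU ≡ 0`, `U` constant, and the constant is axial by the decay
  have hFzero : ∀ x, F x = 0 :=
    eq_zero_of_setIntegral_zSlab_eq_zero hL hFc hF0 hFper hFB hEzero
  have hDU : ∀ x, fderiv ℝ U x = 0 := fun x => HelicalSlab.eq_zero_of_frobeniusNormSq_eq_zero (hFzero x)
  have hconst : ∀ x, U x = U 0 := fun x => is_const_of_fderiv_eq_zero hUd hDU x 0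
  set C₀ : EuclideanSpace ℝ (Fin 3) := U 0 with hC₀
  have hcoord : ∀ (i : Fin 3) (e : EuclideanSpace ℝ (Fin 3)), (∀ s : ℝ, 0 < s → cylRadius (s • e) = s) →
      (∀ s : ℝ, ⟪horizPart (s • e), C₀⟫ = s * C₀ i) → C₀ i = 0 := by
    intro i e hcyl hinner
    by_contra hne
    have hpos : 0 < |C₀ i| := abs_pos.2 hne
    obtain ⟨R, hR⟩ := hdecay' (|C₀ i| / 2) (by positivity)
    set t : ℝ := max R 1 with ht
    have ht1 : 1 ≤ t := le_max_right _ _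
    have ht0 : 0 < t := lt_of_lt_of_le one_pos ht1
    have h1 := hR (t • e) (by rw [hcyl t ht0]; exact le_max_left _ _)
    rw [hconst, hinner t, abs_mul, abs_of_pos ht0] at h1
    nlinarith
  have hc0 : C₀ 0 = 0 := by
    refine hcoord 0 (EuclideanSpace.single 0 1) (fun s hs => ?_) (fun s => ?_)
    · rw [cylRadius_smul_single_zero, abs_of_pos hs]
    · rw [inner_horizPart_left]; simp
  have hc1 : C₀ 1 = 0 := by
    refine hcoord 1 (EuclideanSpace.single 1 1) (fun s hs => ?_) (fun s => ?_)
    · have : cylRadius (s • EuclideanSpace.single 1 (1 : ℝ) : EuclideanSpace ℝ (Fin 3)) = |s| := by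
        rw [cylRadius, ← Real.sqrt_sq_eq_abs]
        congr 1
        simp
      rw [this, abs_of_pos hs]
    · rw [inner_horizPart_left]; simp
  refine ⟨C₀ 2, funext fun x => ?_⟩
  rw [hconst x]
  ext i
  fin_cases i
  · simp [eZ, hc0]
  · simp [eZ, hc1]
  · simp [eZ]

/-- **The Liouville theorem for bounded periodic steady flows with decaying radial velocity
(Bang–Gui–Wang–Xie 2025, Thm 1.4 (c)), any viscosity `ν > 0`.** For `ν > 0` and `L > 0`, a
smooth steady solution `(U, P)` of the unforced Navier–Stokes system on `ℝ³`
(`IsLerayProfile ν 0 U P`, `U, P ∈ C^∞`) with `U` bounded, axially `L`-periodic, and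
`r u^r → 0` uniformly as `r → ∞` (`∀ ε > 0 ∃ R, |ρ(x) u_r(x)| ≤ ε` for `ρ(x) ≥ R`) is an axial
constant `U ≡ c e₃`.
[cite: BangGuiWangXie2025, Thm 1.4 (c), proof §5 (§2: the Bogovskiĭ-type corrector) (source of the ARGUMENT this module implements; this declaration is the cell’s own lemma or plumbing, NOT a printed statement)] -/
theorem periodicSlab_liouville_radialDecay {ν L : ℝ} (hν : 0 < ν) (hL : 0 < L)
    {U : EuclideanSpace ℝ (Fin 3) → EuclideanSpace ℝ (Fin 3)} {P : EuclideanSpace ℝ (Fin 3) → ℝ}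
    (hprof : IsLerayProfile ν 0 U P) (hU : ContDiff ℝ (⊤ : ℕ∞) U) (hP : ContDiff ℝ (⊤ : ℕ∞) P)
    (hbd : ∃ M : ℝ, ∀ x, ‖U x‖ ≤ M) (hper : IsAxiallyPeriodic L U)
    (hdecay : ∀ ε : ℝ, 0 < ε → ∃ R : ℝ, ∀ x, R ≤ cylRadius x →
      |cylRadius x * radialVelocity U x| ≤ ε) :
    ∃ c : ℝ, U = fun _ => c • eZ := by
  obtain ⟨M, hM⟩ := hbd
  set V : EuclideanSpace ℝ (Fin 3) → EuclideanSpace ℝ (Fin 3) := fun x => ν⁻¹ • U x with hV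
  set Q : EuclideanSpace ℝ (Fin 3) → ℝ := fun x => ν⁻¹ ^ 2 • P x with hQ
  have hprof1 : IsLerayProfile 1 0 V Q := hprof.inv_smul_viscosity hν.ne'
  have hVs : ContDiff ℝ (⊤ : ℕ∞) V := hU.const_smul ν⁻¹
  have hQs : ContDiff ℝ (⊤ : ℕ∞) Q := hP.const_smul (ν⁻¹ ^ 2)
  have hVbd : ∃ M' : ℝ, ∀ x, ‖V x‖ ≤ M' := ⟨|ν⁻¹| * M, fun x => by
    show ‖ν⁻¹ • U x‖ ≤ |ν⁻¹| * M
    rw [norm_smul, Real.norm_eq_abs]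
    exact mul_le_mul_of_nonneg_left (hM x) (abs_nonneg _)⟩
  have hVper : IsAxiallyPeriodic L V := fun x => by
    show ν⁻¹ • U (x + L • EuclideanSpace.single 2 (1 : ℝ)) = ν⁻¹ • U x
    rw [hper x]
  have hVdec : ∀ ε : ℝ, 0 < ε → ∃ R : ℝ, ∀ x, R ≤ cylRadius x →
      |cylRadius x * radialVelocity V x| ≤ ε := by
    intro ε hε
    obtain ⟨R, hR⟩ := hdecay (ν * ε) (by positivity)
    refine ⟨R, fun x hx => ?_⟩
    have h1 := hR x hx
    have e : cylRadius x * radialVelocity V x = ν⁻¹ * (cylRadius x * radialVelocity U x) := by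
      simp only [radialVelocity, hV, real_inner_smul_left]; ring
    rw [e, abs_mul, abs_of_pos (inv_pos.2 hν)]
    rw [inv_mul_le_iff₀ hν]
    exact h1
  obtain ⟨c, hc⟩ := periodicSlab_liouville_radialDecay_one hL hprof1 hVs hQs hVbd hVper hVdec
  refine ⟨ν * c, funext fun x => ?_⟩
  have hx : ν⁻¹ • U x = c • eZ := congrFun hc x
  have := congrArg (fun v => ν • v) hx
  simpa [smul_smul, mul_inv_cancel₀ hν.ne'] using this

end Literature.Analysis.SteadySlabLiouville.PeriodicSlab

end Part4

/-! ## Part 5 — the EXACT discharge -/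

namespace Literature.Analysis.FluidPDE

/-- **The named fact `BangGuiWangXie2025_periodicSlab_liouville` HOLDS** (`PeriodicSlabSteadyLiouville.lean`; Bang–Gui–Wang–Xie
2025, Thm 1.4: bounded smooth steady Navier–Stokes flows on `ℝ³`, axially `L`-periodic; (a) `u^θ` independent of `θ` ∨ (b) `u^r`
independent of `θ` ∨ (c) `r u^r → 0` ⇒ `U ≡ c e₃`; (d) `sup ‖U‖ < 2πν/L` ⇒ constant).  Literature-side twin of
`Summit.NavierStokesRegularity.NavierStokesRegularity.Theorems.ScenarioCensus.bangGuiWangXie2025_periodicSlab_liouville_holds`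
(`ScenarioCensusSteadyS7.lean`, same proof): cases (a) `SteadySlabLiouville.PeriodicSlab.periodicSlab_liouville_swirlAxisymmetric`,
(b) `…periodicSlab_liouville_radialAxisymmetric` (both `SteadyPeriodicSlabLiouvilleSymmetricCases.lean`), (c)
`…periodicSlab_liouville_radialDecay` (this file), (d) `…periodicSlab_liouville_small` (`SteadyHelicalLiouvilleHolds.lean`).
[cite: BangGuiWangXie2025, Thm 1.4 (periodic slab, cases (a)–(d); arXiv:2205.13259 §1 p.4, proof §5)] -/
theorem BangGuiWangXie2025_periodicSlab_liouville_holds : BangGuiWangXie2025_periodicSlab_liouville := by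
  intro ν hν L hL U P hUP hU hP hbdd hper
  refine ⟨fun hcase => ?_,
    fun hsmall => SteadySlabLiouville.PeriodicSlab.periodicSlab_liouville_small hν hL hUP hU hP hsmall hper⟩
  rcases hcase with hsw | hrad | hdec
  · exact SteadySlabLiouville.PeriodicSlab.periodicSlab_liouville_swirlAxisymmetric hν hL hUP hU hP hbdd hper hsw
  · exact SteadySlabLiouville.PeriodicSlab.periodicSlab_liouville_radialAxisymmetric hν hL hUP hU hP hbdd hper hrad
  · exact SteadySlabLiouville.PeriodicSlab.periodicSlab_liouville_radialDecay hν hL hUP hU hP hbdd hper hdec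

end Literature.Analysis.FluidPDE

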